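import Mathlib.Analysis.Calculus.BumpFunction.Normed
import Mathlib.Analysis.Calculus.BumpFunction.InnerProduct
import Mathlib.Analysis.Calculus.LineDeriv.Basic
import Mathlib.Analysis.Calculus.ContDiff.Deriv
import Mathlib.Analysis.Calculus.Deriv.Mul
import Mathlib.MeasureTheory.Integral.IntervalIntegral.FundThmCalculus
import Mathlib.MeasureTheory.Integral.Prod
import Mathlib.MeasureTheory.Measure.Haar.InnerProductSpace
import Literature.Analysis.FluidPDE.SolenoidalTruncation
import Literature.Analysis.FluidPDE.VectorCalculus
import HarnessLib

/-!
# An explicit right inverse of the divergence on cubical shells (with loss of one derivative)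

Analysis/FluidPDE support file (everything proved; no named facts) on the discharge path of the
named fact `Literature.Analysis.FluidPDE.SereginWang2020_annular_liouville`
(`SteadyLiouvilleCriteria.lean`; Seregin–Wang 2020, Thm 1.1 (i)). The printed proof of the
Caccioppoli inequality (ibid., Prop. 2.1) corrects the cut-off `φu` of a divergence-free field by
Bogovskiĭ's solution `w` of `div w = u·∇φ` on an annulus (Galdi 2011, §III.3), which is not in
Mathlib or the tree. The tree's substitute (file `SteadyNSRingCorrector`) is
`w = ∇N[f] − w₂`, `N` the truncated Newtonian potential (whose Hessian is `L^p`-bounded by the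
tree's Calderón–Zygmund theory) and `w₂` an EXPLICIT solution of `div w₂ = g` for the smooth,
mean-zero remainder `g = Λ[f]`; this file constructs `w₂`.

**Main result** (`CubeShell.exists_divergence_rightInverse`). There are absolute constants `K, N`
such that for `0 < a < b ≤ 2a` and every `g ∈ C^∞(ℝ³)` supported in the closed cubical shell
`S(a,b) = {x : a ≤ maxᵢ|xᵢ|, maxᵢ|xᵢ| ≤ b}` whose (iterated) integral vanishes, with
`|g| ≤ G₀`, `‖Dg‖ ≤ G₁`, there is `w ∈ C¹(ℝ³; ℝ³)` supported in `S(a,b)` with `div w = g` and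
`‖Dw‖ ≤ K (b/(b−a))^N (G₀ + b G₁)` everywhere. (One derivative is lost — `‖Dw‖` needs `‖Dg‖` —,
which is harmless for a remainder that is smooth at a known scale.)

**Construction** (folklore; the compactly supported Poincaré lemma in top degree, e.g. Bott–Tu,
*Differential forms in algebraic topology*, Prop. 4.6, made quantitative and adapted to the ring):
primitives along coordinate lines. Split `g = g₊ + g₋` smoothly in the sign of `x₀` (transition
inside the hole `|x₀| < a/2`); `x ↦ ∫_{-2b}^{x₀} (g₊ − θ₊(x₀)G₊) dt` with `G₊ = ∫ g₊ dx₀` and a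
bump `θ₊ ∈ C_c^∞((a,b))` of unit mass solves `∂₀(·) = g₊ − θ₊G₊` inside the shell; the remainders
`θ₊G₊ + θ₋G₋` (total mass zero) are re-balanced by a bump `β(x₁,x₂)` of unit mass living in the
slab `x₁ ∈ (a,b)`, the planar mean-zero functions `G₊ − mβ`, `G₋ + mβ` (`m = ∫g₊`) are integrated
along `x₁` and then `x₂` on the square `[-b,b]²`, and the mass `m` is moved from the slab `x₀ > a`
to the slab `x₀ < −a` through the slab `x₁ ∈ (a,b)` by the field `mβ(x₁,x₂)∫^{x₀}(θ₊−θ₋) e₀`.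
All pieces are smooth parametric integrals; only `sup` bounds are tracked.

## Contents

* `§ Coordinates`: `CubeShell.e i`, `CubeShell.lineAt i x t` (replace the `i`-th coordinate),
  the shell `CubeShell.shell a b` and cube `CubeShell.cube b`;
* `§ Bumps`: normalised bumps `CubeShell.bump c w` on `ℝ` and their primitives `CubeShell.step c w`;
* `§ Primitives`: `CubeShell.prim i a₀ g` (`∫_{a₀}^{xᵢ} g` along the `i`-th line), `CubeShell.tot`
  (the full line integral), smoothness, the fundamental theorem of calculus, `sup` and derivative
  bounds;
* `§ Fubini`: the iterated integral `CubeShell.iter b g` equals `∫ g` for continuous `g`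
  supported in the cube;
* `§ Construction` and the main theorem.

## References

* R. Bott, L. W. Tu, *Differential forms in algebraic topology*, GTM 82 (1982), §4, Prop. 4.6
  (integration along the fibre / compactly supported Poincaré lemma).
* G. P. Galdi, *An Introduction to the Mathematical Theory of the Navier–Stokes Equations*,
  2nd ed. (2011), §III.3 (the problem `div w = f`; Bogovskiĭ's formula, not used here).
* G. Seregin, W. Wang, St. Petersburg Math. J. 31 (2020) 387–393 = arXiv:1805.02227, proof of
  Prop. 2.1 (where the corrector enters). [SereginWang2020]
-/

noncomputable section

open MeasureTheory Set Filter Topology Function Metric intervalIntegral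
open scoped RealInnerProductSpace ContDiff NNReal ENNReal

namespace Literature.Analysis.FluidPDE

namespace CubeShell

/-- Local notation for physical space `ℝ³ = EuclideanSpace ℝ (Fin 3)`. -/
local notation "ℝ³" => EuclideanSpace ℝ (Fin 3)

/-! ### § Coordinates -/

section Coordinates

/-- The standard basis vector `eᵢ` of `ℝ³`. [folklore] -/
def e (i : Fin 3) : ℝ³ := EuclideanSpace.single i (1 : ℝ)

/-- Auxiliary (theorem `e_apply`): e apply. [folklore] -/
theorem e_apply (i j : Fin 3) : (e i) j = if j = i then 1 else 0 := by
  simp [e, PiLp.single_apply]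

/-- Auxiliary (`e_apply_same`, simp lemma). [folklore] -/
@[simp] theorem e_apply_same (i : Fin 3) : (e i) i = 1 := by simp [e_apply]

/-- Auxiliary (theorem `e_apply_ne`): e apply ne. [folklore] -/
theorem e_apply_ne {i j : Fin 3} (h : j ≠ i) : (e i) j = 0 := by simp [e_apply, h]

/-- Auxiliary (`norm_e`, simp lemma). [folklore] -/
@[simp] theorem norm_e (i : Fin 3) : ‖e i‖ = 1 := by
  simp [e]

/-- Auxiliary (theorem `inner_e_left`): inner e left. [folklore] -/
theorem inner_e_left (i : Fin 3) (v : ℝ³) : ⟪e i, v⟫ = v i := by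
  simp [e, EuclideanSpace.inner_single_left]

/-- Auxiliary (theorem `inner_e_right`): inner e right. [folklore] -/
theorem inner_e_right (i : Fin 3) (v : ℝ³) : ⟪v, e i⟫ = v i := by
  rw [real_inner_comm, inner_e_left]

/-- Auxiliary (theorem `basisFun_eq_e`): basisFun eq e. [folklore] -/
theorem basisFun_eq_e (i : Fin 3) : EuclideanSpace.basisFun (Fin 3) ℝ i = e i := by
  rw [EuclideanSpace.basisFun_apply]; rfl

/-- The coordinate functions are smooth (they are continuous linear). [folklore] -/
theorem contDiff_coord {n : WithTop ℕ∞} (i : Fin 3) : ContDiff ℝ n (fun x : ℝ³ => x i) :=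
  (EuclideanSpace.proj (𝕜 := ℝ) i).contDiff

/-- Auxiliary (theorem `abs_coord_le_norm`): abs coord le norm. [folklore] -/
theorem abs_coord_le_norm (x : ℝ³) (i : Fin 3) : |x i| ≤ ‖x‖ := by
  simpa using PiLp.norm_apply_le x i

/-- Auxiliary (theorem `add_smul_e_apply_same`): add smul e apply same. [folklore] -/
theorem add_smul_e_apply_same (x : ℝ³) (s : ℝ) (i : Fin 3) : (x + s • e i) i = x i + s := by
  simp

/-- Auxiliary (theorem `add_smul_e_apply_ne`): add smul e apply ne. [folklore] -/
theorem add_smul_e_apply_ne (x : ℝ³) (s : ℝ) {i j : Fin 3} (h : j ≠ i) : (x + s • e i) j = x j := by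
  simp [e_apply_ne h]

/-- The derivative of the coordinate `xⱼ` in the direction `eᵢ` is `δᵢⱼ`. [folklore] -/
theorem fderiv_coord_apply_e (i j : Fin 3) (x : ℝ³) :
    fderiv ℝ (fun y : ℝ³ => y j) x (e i) = if j = i then 1 else 0 := by
  rw [show (fun y : ℝ³ => y j) = (EuclideanSpace.proj (𝕜 := ℝ) j) from rfl,
    ContinuousLinearMap.fderiv]
  exact e_apply i j

/-- `lineAt i x t`: the point `x` with its `i`-th coordinate replaced by `t`. [folklore] -/
def lineAt (i : Fin 3) (x : ℝ³) (t : ℝ) : ℝ³ := x + (t - x i) • e i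

/-- Auxiliary (`lineAt_apply_same`, simp lemma). [folklore] -/
@[simp] theorem lineAt_apply_same (i : Fin 3) (x : ℝ³) (t : ℝ) : (lineAt i x t) i = t := by
  simp [lineAt]

/-- Auxiliary (theorem `lineAt_apply_ne`): lineAt apply ne. [folklore] -/
theorem lineAt_apply_ne {i j : Fin 3} (h : j ≠ i) (x : ℝ³) (t : ℝ) : (lineAt i x t) j = x j := by
  simp [lineAt, e_apply_ne h]

/-- Auxiliary (`lineAt_self`, simp lemma). [folklore] -/
@[simp] theorem lineAt_self (i : Fin 3) (x : ℝ³) : lineAt i x (x i) = x := by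
  simp [lineAt]

/-- Auxiliary (theorem `lineAt_add_smul`): lineAt add smul. [folklore] -/
theorem lineAt_add_smul (i : Fin 3) (x : ℝ³) (s t : ℝ) :
    lineAt i (x + s • e i) t = lineAt i x t := by
  simp only [lineAt, add_smul_e_apply_same]
  module

/-- Auxiliary (`lineAt_lineAt`, simp lemma). [folklore] -/
@[simp] theorem lineAt_lineAt (i : Fin 3) (x : ℝ³) (s t : ℝ) :
    lineAt i (lineAt i x s) t = lineAt i x t := by
  have : lineAt i x s = x + (s - x i) • e i := rfl
  rw [this, lineAt_add_smul]

/-- Auxiliary (theorem `lineAt_eq_add_smul`): lineAt eq add smul. [folklore] -/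
theorem lineAt_eq_add_smul (i : Fin 3) (x : ℝ³) (t : ℝ) : lineAt i x t = x + (t - x i) • e i := rfl

/-- Moving along `eⱼ`, `j ≠ i`, commutes with replacing the `i`-th coordinate. [folklore] -/
theorem lineAt_add_smul_ne {i j : Fin 3} (h : j ≠ i) (x : ℝ³) (s t : ℝ) :
    lineAt i (x + s • e j) t = lineAt i x t + s • e j := by
  simp only [lineAt, add_smul_e_apply_ne x s h.symm]
  module

/-- Auxiliary (theorem `lineAt_lineAt_comm`): lineAt lineAt comm. [folklore] -/
theorem lineAt_lineAt_comm {i j : Fin 3} (h : j ≠ i) (x : ℝ³) (s t : ℝ) :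
    lineAt i (lineAt j x s) t = lineAt j (lineAt i x t) s := by
  rw [lineAt_eq_add_smul i (lineAt j x s), lineAt_apply_ne h.symm,
    lineAt_eq_add_smul j (lineAt i x t), lineAt_apply_ne h, lineAt_eq_add_smul,
    lineAt_eq_add_smul]
  module

/-- Auxiliary (theorem `norm_lineAt_sub_lineAt_le`): norm lineAt sub lineAt le. [folklore] -/
theorem norm_lineAt_sub_lineAt_le (i : Fin 3) (x y : ℝ³) (t : ℝ) :
    ‖lineAt i y t - lineAt i x t‖ ≤ 2 * ‖y - x‖ := by
  have h : lineAt i y t - lineAt i x t = (y - x) - ((y - x) i) • e i := by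
    simp only [lineAt, PiLp.sub_apply]
    module
  rw [h]
  calc ‖(y - x) - ((y - x) i) • e i‖ ≤ ‖y - x‖ + ‖((y - x) i) • e i‖ := norm_sub_le _ _
    _ = ‖y - x‖ + |(y - x) i| := by rw [norm_smul, norm_e, mul_one, Real.norm_eq_abs]
    _ ≤ ‖y - x‖ + ‖y - x‖ := by gcongr; exact abs_coord_le_norm _ _
    _ = 2 * ‖y - x‖ := by ring

/-- `(x, t) ↦ lineAt i x t` is smooth (it is affine in each variable). [folklore] -/
theorem contDiff_lineAt_uncurry (i : Fin 3) :
    ContDiff ℝ ∞ (fun p : ℝ³ × ℝ => lineAt i p.1 p.2) := by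
  unfold lineAt
  have h1 : ContDiff ℝ ∞ (fun p : ℝ³ × ℝ => p.1 i) := (contDiff_coord i).comp contDiff_fst
  exact contDiff_fst.add ((contDiff_snd.sub h1).smul contDiff_const)

/-- Auxiliary (theorem `contDiff_lineAt`): contDiff lineAt. [folklore] -/
theorem contDiff_lineAt (i : Fin 3) (x : ℝ³) : ContDiff ℝ ∞ (lineAt i x) :=
  (contDiff_lineAt_uncurry i).comp (contDiff_prodMk_right x)

/-- Auxiliary (theorem `continuous_lineAt`): continuous lineAt. [folklore] -/
theorem continuous_lineAt (i : Fin 3) (x : ℝ³) : Continuous (lineAt i x) :=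
  (contDiff_lineAt i x).continuous

/-- Auxiliary (theorem `contDiff_lineAt_left`): contDiff lineAt left. [folklore] -/
theorem contDiff_lineAt_left (i : Fin 3) (t : ℝ) : ContDiff ℝ ∞ (fun x : ℝ³ => lineAt i x t) :=
  (contDiff_lineAt_uncurry i).comp (contDiff_prodMk_left t)

/-- The closed cube `{maxᵢ |xᵢ| ≤ b}`. [folklore] -/
def cube (b : ℝ) : Set ℝ³ := {x | ∀ i, |x i| ≤ b}

/-- The closed cubical shell `{a ≤ maxᵢ |xᵢ| ≤ b}`. [folklore] -/
def shell (a b : ℝ) : Set ℝ³ := {x | (∃ i, a ≤ |x i|) ∧ ∀ i, |x i| ≤ b}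

/-- Auxiliary (theorem `shell_subset_cube`): shell subset cube. [folklore] -/
theorem shell_subset_cube (a b : ℝ) : shell a b ⊆ cube b := fun _ hx => hx.2

/-- Auxiliary (theorem `mem_cube`): mem cube. [folklore] -/
theorem mem_cube {b : ℝ} {x : ℝ³} : x ∈ cube b ↔ ∀ i, |x i| ≤ b := Iff.rfl

/-- Auxiliary (theorem `mem_shell`): mem shell. [folklore] -/
theorem mem_shell {a b : ℝ} {x : ℝ³} : x ∈ shell a b ↔ (∃ i, a ≤ |x i|) ∧ ∀ i, |x i| ≤ b :=
  Iff.rfl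

/-- Auxiliary (theorem `not_mem_shell`): not mem shell. [folklore] -/
theorem not_mem_shell {a b : ℝ} {x : ℝ³} :
    x ∉ shell a b ↔ (∀ i, |x i| < a) ∨ ∃ i, b < |x i| := by
  rw [mem_shell, not_and_or, not_exists, not_forall]
  simp only [not_le]

/-- Auxiliary (theorem `continuous_coord`): continuous coord. [folklore] -/
theorem continuous_coord (i : Fin 3) : Continuous fun x : ℝ³ => x i :=
  (contDiff_coord (n := 0) i).continuous

/-- Auxiliary (theorem `isClosed_cube`): isClosed cube. [folklore] -/
theorem isClosed_cube (b : ℝ) : IsClosed (cube b) := by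
  have : cube b = ⋂ i, {x : ℝ³ | |x i| ≤ b} := by ext x; simp [cube]
  rw [this]
  exact isClosed_iInter fun i => isClosed_le (continuous_abs.comp (continuous_coord i))
    continuous_const

/-- Auxiliary (theorem `isClosed_shell`): isClosed shell. [folklore] -/
theorem isClosed_shell (a b : ℝ) : IsClosed (shell a b) := by
  have : shell a b = (⋃ i, {x : ℝ³ | a ≤ |x i|}) ∩ cube b := by
    ext x; simp [shell, cube]
  rw [this]
  refine IsClosed.inter ?_ (isClosed_cube b)
  exact isClosed_iUnion_of_finite fun i => isClosed_le continuous_const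
    (continuous_abs.comp (continuous_coord i))

/-- Auxiliary (theorem `norm_le_of_mem_cube`): norm le of mem cube. [folklore] -/
theorem norm_le_of_mem_cube {b : ℝ} {x : ℝ³} (hx : x ∈ cube b) : ‖x‖ ≤ 3 * b := by
  have hb : 0 ≤ b := (abs_nonneg _).trans (hx 0)
  rw [EuclideanSpace.norm_eq]
  have hsum : ∑ i, ‖x i‖ ^ 2 ≤ 3 * b ^ 2 := by
    have : ∀ i, ‖x i‖ ^ 2 ≤ b ^ 2 := fun i => by
      rw [Real.norm_eq_abs]; exact pow_le_pow_left₀ (abs_nonneg _) (hx i) 2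
    calc ∑ i, ‖x i‖ ^ 2 ≤ ∑ _i : Fin 3, b ^ 2 := Finset.sum_le_sum fun i _ => this i
      _ = 3 * b ^ 2 := by simp
  calc Real.sqrt (∑ i, ‖x i‖ ^ 2) ≤ Real.sqrt (3 * b ^ 2) := Real.sqrt_le_sqrt hsum
    _ ≤ Real.sqrt ((3 * b) ^ 2) := Real.sqrt_le_sqrt (by nlinarith)
    _ = 3 * b := Real.sqrt_sq (by linarith)

/-- Auxiliary (theorem `cube_subset_closedBall`): cube subset closedBall. [folklore] -/
theorem cube_subset_closedBall (b : ℝ) : cube b ⊆ closedBall (0 : ℝ³) (3 * b) := fun _ hx =>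
  mem_closedBall_zero_iff.2 (norm_le_of_mem_cube hx)

/-- Auxiliary (theorem `isCompact_cube`): isCompact cube. [folklore] -/
theorem isCompact_cube (b : ℝ) : IsCompact (cube b) :=
  (isCompact_closedBall (0 : ℝ³) (3 * b)).of_isClosed_subset (isClosed_cube b)
    (cube_subset_closedBall b)

/-- Auxiliary (theorem `isCompact_shell`): isCompact shell. [folklore] -/
theorem isCompact_shell (a b : ℝ) : IsCompact (shell a b) :=
  (isCompact_cube b).of_isClosed_subset (isClosed_shell a b) (shell_subset_cube a b)

/-- Auxiliary (theorem `lineAt_mem_cube`): lineAt mem cube. [folklore] -/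
theorem lineAt_mem_cube {b : ℝ} {x : ℝ³} (hx : x ∈ cube b) (i : Fin 3) {t : ℝ} (ht : |t| ≤ b) :
    lineAt i x t ∈ cube b := by
  intro j
  by_cases h : j = i
  · subst h; simpa using ht
  · rw [lineAt_apply_ne h]; exact hx j

end Coordinates

/-! ### § Bumps on the line -/

section Bumps

/-- A fixed smooth bump on `ℝ`, nonnegative, of unit mass, supported in `[-1/2, 1/2]`
(Mathlib's normalised `ContDiffBump`). [folklore] -/
def ψ₀ : ℝ → ℝ := (⟨1 / 4, 1 / 2, by norm_num, by norm_num⟩ : ContDiffBump (0 : ℝ)).normed volume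

/-- Auxiliary (theorem `ψ₀_contDiff`): ψ₀ contDiff. [folklore] -/
theorem ψ₀_contDiff {n : ℕ∞} : ContDiff ℝ n ψ₀ := ContDiffBump.contDiff_normed _

/-- Auxiliary (theorem `ψ₀_nonneg`): ψ₀ nonneg. [folklore] -/
theorem ψ₀_nonneg (t : ℝ) : 0 ≤ ψ₀ t := ContDiffBump.nonneg_normed _ _

/-- Auxiliary (theorem `integral_ψ₀`): integral ψ₀. [folklore] -/
theorem integral_ψ₀ : ∫ t, ψ₀ t = 1 := ContDiffBump.integral_normed _

/-- Auxiliary (theorem `ψ₀_eq_zero`): ψ₀ eq zero. [folklore] -/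
theorem ψ₀_eq_zero {t : ℝ} (ht : 1 / 2 ≤ |t|) : ψ₀ t = 0 := by
  have h : t ∉ support ψ₀ := by
    rw [ψ₀, ContDiffBump.support_normed_eq, mem_ball_zero_iff, Real.norm_eq_abs, not_lt]
    exact ht
  simpa [mem_support] using h

/-- Auxiliary (theorem `support_ψ₀_subset`): support ψ₀ subset. [folklore] -/
theorem support_ψ₀_subset : support ψ₀ ⊆ Icc (-(1 / 2)) (1 / 2) := by
  intro t ht
  by_contra h
  refine ht (ψ₀_eq_zero ?_)
  rw [mem_Icc, not_and_or, not_le, not_le] at h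
  rcases h with h | h
  · rw [abs_of_neg (by linarith)]; linarith
  · rw [abs_of_pos (by linarith)]; linarith

/-- Auxiliary (theorem `hasCompactSupport_ψ₀`): hasCompactSupport ψ₀. [folklore] -/
theorem hasCompactSupport_ψ₀ : HasCompactSupport ψ₀ :=
  HasCompactSupport.of_support_subset_isCompact isCompact_Icc support_ψ₀_subset

/-- Auxiliary (theorem `continuous_ψ₀`): continuous ψ₀. [folklore] -/
theorem continuous_ψ₀ : Continuous ψ₀ := (ψ₀_contDiff (n := 0)).continuous

/-- `sup |ψ₀|` and `sup |ψ₀'|` (some finite constants; their values are never used). [folklore] -/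
theorem exists_ψ₀_bounds : ∃ B : ℝ, 1 ≤ B ∧ (∀ t, |ψ₀ t| ≤ B) ∧ ∀ t, |deriv ψ₀ t| ≤ B := by
  obtain ⟨B₀, hB₀⟩ := (continuous_ψ₀.norm).bddAbove_range_of_hasCompactSupport
    hasCompactSupport_ψ₀.norm
  have hd : Continuous (deriv ψ₀) := (ψ₀_contDiff (n := 1)).continuous_deriv le_rfl
  obtain ⟨B₁, hB₁⟩ := (hd.norm).bddAbove_range_of_hasCompactSupport
    (hasCompactSupport_ψ₀.deriv).norm
  refine ⟨max 1 (max B₀ B₁), le_max_left _ _, fun t => ?_, fun t => ?_⟩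
  · have h : ‖ψ₀ t‖ ≤ B₀ := hB₀ ⟨t, rfl⟩
    rw [Real.norm_eq_abs] at h
    exact h.trans ((le_max_left _ _).trans (le_max_right _ _))
  · have h : ‖deriv ψ₀ t‖ ≤ B₁ := hB₁ ⟨t, rfl⟩
    rw [Real.norm_eq_abs] at h
    exact h.trans ((le_max_right _ _).trans (le_max_right _ _))

/-- The universal bump constant `B ≥ 1` with `|ψ₀|, |ψ₀'| ≤ B`. [folklore] -/
def B : ℝ := Classical.choose exists_ψ₀_bounds

/-- Auxiliary (theorem `one_le_B`): one le B. [folklore] -/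
theorem one_le_B : 1 ≤ B := (Classical.choose_spec exists_ψ₀_bounds).1

/-- Auxiliary (theorem `B_pos`): B pos. [folklore] -/
theorem B_pos : 0 < B := one_pos.trans_le one_le_B

/-- Auxiliary (theorem `abs_ψ₀_le`): abs ψ₀ le. [folklore] -/
theorem abs_ψ₀_le (t : ℝ) : |ψ₀ t| ≤ B := (Classical.choose_spec exists_ψ₀_bounds).2.1 t

/-- Auxiliary (theorem `abs_deriv_ψ₀_le`): abs deriv ψ₀ le. [folklore] -/
theorem abs_deriv_ψ₀_le (t : ℝ) : |deriv ψ₀ t| ≤ B := (Classical.choose_spec exists_ψ₀_bounds).2.2 t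

variable {c w : ℝ}

/-- The bump of unit mass centred at `c` of width `w > 0`: `w⁻¹ ψ₀((t - c)/w)`, supported in
`[c - w/2, c + w/2]`. [folklore] -/
def bump (c w : ℝ) (t : ℝ) : ℝ := w⁻¹ * ψ₀ ((t - c) / w)

/-- Auxiliary (theorem `bump_contDiff`): bump contDiff. [folklore] -/
theorem bump_contDiff (c w : ℝ) {n : ℕ∞} : ContDiff ℝ n (bump c w) := by
  unfold bump
  exact contDiff_const.mul (ψ₀_contDiff.comp ((contDiff_id.sub contDiff_const).div_const w))

/-- Auxiliary (theorem `continuous_bump`): continuous bump. [folklore] -/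
theorem continuous_bump (c w : ℝ) : Continuous (bump c w) := (bump_contDiff c w (n := 0)).continuous

/-- Auxiliary (theorem `bump_nonneg`): bump nonneg. [folklore] -/
theorem bump_nonneg (hw : 0 < w) (t : ℝ) : 0 ≤ bump c w t :=
  mul_nonneg (inv_nonneg.2 hw.le) (ψ₀_nonneg _)

/-- Auxiliary (theorem `bump_eq_zero`): bump eq zero. [folklore] -/
theorem bump_eq_zero (hw : 0 < w) {t : ℝ} (ht : w / 2 ≤ |t - c|) : bump c w t = 0 := by
  rw [bump, ψ₀_eq_zero, mul_zero]
  rw [abs_div, abs_of_pos hw, le_div_iff₀ hw]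
  linarith

/-- Auxiliary (theorem `bump_eq_zero_of_le`): bump eq zero of le. [folklore] -/
theorem bump_eq_zero_of_le (hw : 0 < w) {t : ℝ} (ht : t ≤ c - w / 2) : bump c w t = 0 :=
  bump_eq_zero hw (by rw [abs_of_nonpos (by linarith)]; linarith)

/-- Auxiliary (theorem `bump_eq_zero_of_ge`): bump eq zero of ge. [folklore] -/
theorem bump_eq_zero_of_ge (hw : 0 < w) {t : ℝ} (ht : c + w / 2 ≤ t) : bump c w t = 0 :=
  bump_eq_zero hw (by rw [abs_of_nonneg (by linarith)]; linarith)

/-- Auxiliary (theorem `support_bump_subset`): support bump subset. [folklore] -/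
theorem support_bump_subset (hw : 0 < w) : support (bump c w) ⊆ Icc (c - w / 2) (c + w / 2) := by
  intro t ht
  rw [mem_support] at ht
  by_contra h
  rw [mem_Icc, not_and_or, not_le, not_le] at h
  rcases h with h | h
  · exact ht (bump_eq_zero_of_le hw h.le)
  · exact ht (bump_eq_zero_of_ge hw h.le)

/-- Auxiliary (theorem `hasCompactSupport_bump`): hasCompactSupport bump. [folklore] -/
theorem hasCompactSupport_bump (hw : 0 < w) : HasCompactSupport (bump c w) :=
  HasCompactSupport.of_support_subset_isCompact isCompact_Icc (support_bump_subset hw)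

/-- Auxiliary (theorem `integral_bump`): integral bump. [folklore] -/
theorem integral_bump (hw : 0 < w) : ∫ t, bump c w t = 1 := by
  unfold bump
  rw [MeasureTheory.integral_const_mul]
  have h1 : ∫ t : ℝ, ψ₀ ((t - c) / w) = ∫ t : ℝ, ψ₀ (t / w) := by
    have := integral_sub_right_eq_self (μ := (volume : Measure ℝ)) (fun t => ψ₀ (t / w)) c
    exact this
  rw [h1, Measure.integral_comp_div (fun t => ψ₀ t) w, integral_ψ₀, abs_of_pos hw, smul_eq_mul,
    mul_one, inv_mul_cancel₀ hw.ne']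

/-- Auxiliary (theorem `abs_bump_le`): abs bump le. [folklore] -/
theorem abs_bump_le (hw : 0 < w) (t : ℝ) : |bump c w t| ≤ B / w := by
  rw [bump, abs_mul, abs_inv, abs_of_pos hw, div_eq_inv_mul B w]
  exact mul_le_mul_of_nonneg_left (abs_ψ₀_le _) (inv_nonneg.2 hw.le)

/-- Auxiliary (theorem `hasDerivAt_bump`): hasDerivAt bump. [folklore] -/
theorem hasDerivAt_bump (t : ℝ) :
    HasDerivAt (bump c w) (w⁻¹ * (deriv ψ₀ ((t - c) / w) * w⁻¹)) t := by
  unfold bump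
  have h1 : HasDerivAt (fun t => (t - c) / w) w⁻¹ t := by
    simpa using ((hasDerivAt_id t).sub_const c).div_const w
  have h2 : HasDerivAt ψ₀ (deriv ψ₀ ((t - c) / w)) ((t - c) / w) :=
    ((ψ₀_contDiff (n := 1)).differentiable (by simp) _).hasDerivAt
  exact (h2.comp t h1).const_mul _

/-- Auxiliary (theorem `abs_deriv_bump_le`): abs deriv bump le. [folklore] -/
theorem abs_deriv_bump_le (hw : 0 < w) (t : ℝ) : |deriv (bump c w) t| ≤ B / w ^ 2 := by
  rw [(hasDerivAt_bump t).deriv, abs_mul, abs_mul, abs_inv, abs_of_pos hw]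
  calc w⁻¹ * (|deriv ψ₀ ((t - c) / w)| * w⁻¹) ≤ w⁻¹ * (B * w⁻¹) := by
        gcongr
        exact abs_deriv_ψ₀_le _
    _ = B / w ^ 2 := by field_simp

/-- The smooth step `Θ(s) = ∫_{c-w}^{s} bump`: `0` for `s ≤ c - w/2`, `1` for `s ≥ c + w/2`,
values in `[0, 1]`, derivative `bump c w`. [folklore] -/
def step (c w : ℝ) (s : ℝ) : ℝ := ∫ t in (c - w)..s, bump c w t

/-- Auxiliary (theorem `hasDerivAt_step`): hasDerivAt step. [folklore] -/
theorem hasDerivAt_step (c w : ℝ) (s : ℝ) : HasDerivAt (step c w) (bump c w s) s :=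
  intervalIntegral.integral_hasDerivAt_right ((continuous_bump c w).intervalIntegrable _ _)
    ((continuous_bump c w).stronglyMeasurableAtFilter _ _) (continuous_bump c w).continuousAt

/-- Auxiliary (theorem `deriv_step`): deriv step. [folklore] -/
theorem deriv_step (c w : ℝ) : deriv (step c w) = bump c w :=
  funext fun s => (hasDerivAt_step c w s).deriv

/-- Auxiliary (theorem `differentiable_step`): differentiable step. [folklore] -/
theorem differentiable_step (c w : ℝ) : Differentiable ℝ (step c w) := fun s =>
  (hasDerivAt_step c w s).differentiableAt

/-- Auxiliary (theorem `step_contDiff`): step contDiff. [folklore] -/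
theorem step_contDiff (c w : ℝ) {n : ℕ∞} : ContDiff ℝ n (step c w) := by
  have h : ContDiff ℝ ∞ (step c w) := by
    rw [contDiff_infty_iff_deriv, deriv_step]
    exact ⟨differentiable_step c w, bump_contDiff c w⟩
  exact h.of_le (by exact_mod_cast le_top)

/-- Auxiliary (theorem `continuous_step`): continuous step. [folklore] -/
theorem continuous_step (c w : ℝ) : Continuous (step c w) := (step_contDiff c w (n := 0)).continuous

/-- Auxiliary (theorem `step_eq_zero`): step eq zero. [folklore] -/
theorem step_eq_zero (hw : 0 < w) {s : ℝ} (hs : s ≤ c - w / 2) : step c w s = 0 := by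
  unfold step
  refine intervalIntegral.integral_zero_ae (Eventually.of_forall fun t ht => ?_)
  -- on `uIoc (c - w) s` the bump vanishes: both endpoints are `≤ c - w/2`
  have ht' : t ≤ c - w / 2 := by
    rcases mem_uIoc.1 ht with ⟨_, h2⟩ | ⟨_, h2⟩
    · exact h2.trans hs
    · linarith
  exact bump_eq_zero_of_le hw ht'

/-- Auxiliary (theorem `step_eq_one`): step eq one. [folklore] -/
theorem step_eq_one (hw : 0 < w) {s : ℝ} (hs : c + w / 2 ≤ s) : step c w s = 1 := by
  unfold step
  rw [intervalIntegral.integral_eq_integral_of_support_subset, integral_bump hw]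
  refine (support_bump_subset hw).trans fun t ht => ⟨?_, ht.2.trans hs⟩
  have := ht.1; linarith

/-- Auxiliary (theorem `step_nonneg`): step nonneg. [folklore] -/
theorem step_nonneg (hw : 0 < w) (s : ℝ) : 0 ≤ step c w s := by
  by_cases hs : c - w ≤ s
  · exact intervalIntegral.integral_nonneg hs fun t _ => bump_nonneg hw t
  · rw [step_eq_zero hw (by linarith)]

/-- Auxiliary (theorem `step_le_one`): step le one. [folklore] -/
theorem step_le_one (hw : 0 < w) (s : ℝ) : step c w s ≤ 1 := by
  by_cases hs : c - w ≤ s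
  · unfold step
    rw [intervalIntegral.integral_of_le hs, ← integral_bump (c := c) hw]
    exact setIntegral_le_integral ((continuous_bump c w).integrable_of_hasCompactSupport
      (hasCompactSupport_bump hw)) (Eventually.of_forall fun t => bump_nonneg hw t)
  · rw [step_eq_zero hw (by linarith)]; exact zero_le_one

/-- Auxiliary (theorem `abs_step_le_one`): abs step le one. [folklore] -/
theorem abs_step_le_one (hw : 0 < w) (s : ℝ) : |step c w s| ≤ 1 := by
  rw [abs_of_nonneg (step_nonneg hw s)]; exact step_le_one hw s

end Bumps

/-! ### § Primitives along coordinate lines -/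

section Primitives

variable {g : ℝ³ → ℝ} {i : Fin 3} {a₀ b₀ : ℝ}

/-- The primitive of `g` along the `i`-th coordinate line from height `a₀`:
`prim i a₀ g x = ∫_{a₀}^{xᵢ} g(x with xᵢ := t) dt`. [folklore] -/
def prim (i : Fin 3) (a₀ : ℝ) (g : ℝ³ → ℝ) (x : ℝ³) : ℝ :=
  ∫ t in a₀..(x i), g (lineAt i x t)

/-- The full line integral `tot i a₀ b₀ g x = ∫_{a₀}^{b₀} g(x with xᵢ := t) dt` (a function of
the other two coordinates). [folklore] -/
def tot (i : Fin 3) (a₀ b₀ : ℝ) (g : ℝ³ → ℝ) (x : ℝ³) : ℝ :=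
  ∫ t in a₀..b₀, g (lineAt i x t)

/-- Auxiliary (theorem `prim_apply`): prim apply. [folklore] -/
theorem prim_apply (i : Fin 3) (a₀ : ℝ) (g : ℝ³ → ℝ) (x : ℝ³) :
    prim i a₀ g x = ∫ t in a₀..(x i), g (lineAt i x t) := rfl

/-- Auxiliary (theorem `tot_apply`): tot apply. [folklore] -/
theorem tot_apply (i : Fin 3) (a₀ b₀ : ℝ) (g : ℝ³ → ℝ) (x : ℝ³) :
    tot i a₀ b₀ g x = ∫ t in a₀..b₀, g (lineAt i x t) := rfl

/-- `tot` does not depend on the `i`-th coordinate. [folklore] -/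
theorem tot_lineAt (i : Fin 3) (a₀ b₀ : ℝ) (g : ℝ³ → ℝ) (x : ℝ³) (s : ℝ) :
    tot i a₀ b₀ g (lineAt i x s) = tot i a₀ b₀ g x := by
  simp only [tot, lineAt_lineAt]

/-- Auxiliary (theorem `tot_add_smul`): tot add smul. [folklore] -/
theorem tot_add_smul (i : Fin 3) (a₀ b₀ : ℝ) (g : ℝ³ → ℝ) (x : ℝ³) (s : ℝ) :
    tot i a₀ b₀ g (x + s • e i) = tot i a₀ b₀ g x := by
  simp only [tot, lineAt_add_smul]

/-- `prim` at a point of the line depends only on the height. [folklore] -/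
theorem prim_lineAt (i : Fin 3) (a₀ : ℝ) (g : ℝ³ → ℝ) (x : ℝ³) (s : ℝ) :
    prim i a₀ g (lineAt i x s) = ∫ t in a₀..s, g (lineAt i x t) := by
  simp only [prim, lineAt_lineAt, lineAt_apply_same]

/-- Invariance under moving another coordinate is inherited by `tot` and `prim`. [folklore] -/
theorem tot_lineAt_of_invariant {j : Fin 3} (h : j ≠ i) (hg : ∀ x s, g (lineAt j x s) = g x)
    (x : ℝ³) (s : ℝ) : tot i a₀ b₀ g (lineAt j x s) = tot i a₀ b₀ g x := by
  simp only [tot, lineAt_lineAt_comm h, hg]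

/-- Auxiliary (theorem `prim_lineAt_of_invariant`): prim lineAt of invariant. [folklore] -/
theorem prim_lineAt_of_invariant {j : Fin 3} (h : j ≠ i) (hg : ∀ x s, g (lineAt j x s) = g x)
    (x : ℝ³) (s : ℝ) : prim i a₀ g (lineAt j x s) = prim i a₀ g x := by
  simp only [prim, lineAt_lineAt_comm h, hg, lineAt_apply_ne h.symm]

/-! #### Smoothness -/

/-- Substitution `t = a₀ + s(xᵢ - a₀)`: `prim` as an integral over the unit interval. [folklore] -/
theorem prim_eq_mul_integral_unit (i : Fin 3) (a₀ : ℝ) (g : ℝ³ → ℝ) (x : ℝ³) :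
    prim i a₀ g x = (x i - a₀) * ∫ s in (0:ℝ)..1, g (lineAt i x (a₀ + s * (x i - a₀))) := by
  unfold prim
  have h := intervalIntegral.smul_integral_comp_mul_add (fun t => g (lineAt i x t)) (x i - a₀) a₀
    (a := 0) (b := 1)
  simp only [mul_zero, zero_add, mul_one, sub_add_cancel, smul_eq_mul] at h
  rw [← h]
  congr 1
  refine intervalIntegral.integral_congr fun s _ => ?_
  simp only; ring_nf

/-- **`prim i a₀ g` is smooth for smooth `g`** (a smooth parametric integral over `[0, 1]`; the
tree's `contDiff_intervalIntegral_of_contDiff`). [folklore] -/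
theorem contDiff_prim (i : Fin 3) (a₀ : ℝ) (hg : ContDiff ℝ ∞ g) : ContDiff ℝ ∞ (prim i a₀ g) := by
  have h : prim i a₀ g = fun x => (x i - a₀) * ∫ s in (0:ℝ)..1, g (lineAt i x (a₀ + s * (x i - a₀))) :=
    funext (prim_eq_mul_integral_unit i a₀ g)
  rw [h]
  have h1 : ContDiff ℝ ∞ (fun x : ℝ³ => x i - a₀) := (contDiff_coord i).sub contDiff_const
  refine h1.mul ?_
  refine contDiff_intervalIntegral_of_contDiff
    (f := fun x s => g (lineAt i x (a₀ + s * (x i - a₀)))) ?_ 0 1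
  refine hg.comp ?_
  have h2 : ContDiff ℝ ∞ (fun p : ℝ³ × ℝ => (p.1, a₀ + p.2 * (p.1 i - a₀))) := by
    refine contDiff_fst.prodMk ?_
    exact contDiff_const.add (contDiff_snd.mul (((contDiff_coord i).comp contDiff_fst).sub
      contDiff_const))
  exact (contDiff_lineAt_uncurry i).comp h2

/-- `tot i a₀ b₀ g` is smooth for smooth `g`. [folklore] -/
theorem contDiff_tot (i : Fin 3) (a₀ b₀ : ℝ) (hg : ContDiff ℝ ∞ g) :
    ContDiff ℝ ∞ (tot i a₀ b₀ g) :=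
  contDiff_intervalIntegral_of_contDiff (f := fun x t => g (lineAt i x t))
    (hg.comp (contDiff_lineAt_uncurry i)) a₀ b₀

/-- Auxiliary (theorem `continuous_tot`): continuous tot. [folklore] -/
theorem continuous_tot (i : Fin 3) (a₀ b₀ : ℝ) (hg : Continuous g) :
    Continuous (tot i a₀ b₀ g) :=
  intervalIntegral.continuous_parametric_intervalIntegral_of_continuous'
    (f := fun x t => g (lineAt i x t)) (hg.comp (contDiff_lineAt_uncurry i).continuous) a₀ b₀

/-! #### The fundamental theorem of calculus along the line -/

/-- **`∂ᵢ (prim i a₀ g) = g`.** [folklore] -/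
theorem fderiv_prim_apply_e_self (i : Fin 3) (a₀ : ℝ) (hg : ContDiff ℝ ∞ g) (x : ℝ³) :
    fderiv ℝ (prim i a₀ g) x (e i) = g x := by
  have hd : DifferentiableAt ℝ (prim i a₀ g) x := (contDiff_prim i a₀ hg).differentiable (by simp) x
  rw [← hd.lineDeriv_eq_fderiv]
  have hcont : Continuous fun t => g (lineAt i x t) := hg.continuous.comp (continuous_lineAt i x)
  have h1 : HasDerivAt (fun u => ∫ t in a₀..u, g (lineAt i x t)) (g (lineAt i x (x i))) (x i) :=
    intervalIntegral.integral_hasDerivAt_right (hcont.intervalIntegrable _ _)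
      (hcont.stronglyMeasurableAtFilter _ _) hcont.continuousAt
  rw [lineAt_self] at h1
  have h2 : HasLineDerivAt ℝ (prim i a₀ g) (g x) x (e i) := by
    have h3 : HasDerivAt (fun u => ∫ t in a₀..u, g (lineAt i x t)) (g x) (x i + 0) := by
      rwa [add_zero]
    have h4 := h3.comp_const_add (x i) 0
    refine HasDerivAt.congr_of_eventuallyEq (f := fun s => ∫ t in a₀..(x i + s), g (lineAt i x t))
      (by simpa using h4) (Eventually.of_forall fun s => ?_)
    simp only [prim, lineAt_add_smul, add_smul_e_apply_same]
  exact h2.lineDeriv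

/-- `∂ᵢ (tot i a₀ b₀ g) = 0`. [folklore] -/
theorem fderiv_tot_apply_e_self (i : Fin 3) (a₀ b₀ : ℝ) (hg : ContDiff ℝ ∞ g) (x : ℝ³) :
    fderiv ℝ (tot i a₀ b₀ g) x (e i) = 0 := by
  have hd : DifferentiableAt ℝ (tot i a₀ b₀ g) x :=
    (contDiff_tot i a₀ b₀ hg).differentiable (by simp) x
  rw [← hd.lineDeriv_eq_fderiv]
  have h2 : HasLineDerivAt ℝ (tot i a₀ b₀ g) 0 x (e i) := by
    refine HasDerivAt.congr_of_eventuallyEq (f := fun _ : ℝ => tot i a₀ b₀ g x) (hasDerivAt_const _ _)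
      (Eventually.of_forall fun s => ?_)
    simp only [tot_add_smul]
  exact h2.lineDeriv

/-- A function invariant along `eᵢ` has `∂ᵢ = 0`. [folklore] -/
theorem fderiv_apply_e_eq_zero_of_invariant {F : ℝ³ → ℝ} (hF : ∀ (x : ℝ³) (s : ℝ), F (x + s • e i) = F x)
    (x : ℝ³) : fderiv ℝ F x (e i) = 0 := by
  by_cases hd : DifferentiableAt ℝ F x
  · rw [← hd.lineDeriv_eq_fderiv]
    have h2 : HasLineDerivAt ℝ F 0 x (e i) := by
      refine HasDerivAt.congr_of_eventuallyEq (f := fun _ : ℝ => F x) (hasDerivAt_const _ _)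
        (Eventually.of_forall fun s => ?_)
      simp only [hF]
    exact h2.lineDeriv
  · rw [fderiv_zero_of_not_differentiableAt hd]; rfl

end Primitives

/-! ### § Bounds for the primitives -/

section Bounds

variable {g : ℝ³ → ℝ} {i : Fin 3} {a₀ b₀ : ℝ}

/-- The operator norm of a functional on `ℝ³` is at most the sum of its values on the basis.
[folklore] -/
theorem opNorm_le_sum_abs_apply_e (L : ℝ³ →L[ℝ] ℝ) : ‖L‖ ≤ ∑ j, |L (e j)| := by
  refine ContinuousLinearMap.opNorm_le_bound _ (Finset.sum_nonneg fun j _ => abs_nonneg _)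
    fun v => ?_
  have hv : v = ∑ j, v j • e j := by
    have := (EuclideanSpace.basisFun (Fin 3) ℝ).sum_repr v
    simp only [basisFun_eq_e, EuclideanSpace.basisFun_repr] at this
    exact this.symm
  calc ‖L v‖ = ‖∑ j, v j • L (e j)‖ := by
        conv_lhs => rw [hv]
        simp only [map_sum, map_smul, smul_eq_mul]
    _ ≤ ∑ j, ‖v j • L (e j)‖ := norm_sum_le _ _
    _ = ∑ j, |v j| * |L (e j)| := by simp only [smul_eq_mul, norm_mul, Real.norm_eq_abs]
    _ ≤ ∑ j, ‖v‖ * |L (e j)| := Finset.sum_le_sum fun j _ =>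
        mul_le_mul_of_nonneg_right (abs_coord_le_norm v j) (abs_nonneg _)
    _ = (∑ j, |L (e j)|) * ‖v‖ := by rw [← Finset.mul_sum, mul_comm]

/-- `‖DF(x)‖ ≤ Σⱼ |∂ⱼF(x)|` for scalar `F`. [folklore] -/
theorem norm_fderiv_le_sum (F : ℝ³ → ℝ) (x : ℝ³) :
    ‖fderiv ℝ F x‖ ≤ ∑ j, |fderiv ℝ F x (e j)| :=
  opNorm_le_sum_abs_apply_e _

/-- **Mean value inequality** from a global derivative bound. [folklore] -/
theorem abs_sub_le_of_fderiv_bound (hg : Differentiable ℝ g) {G₁ : ℝ}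
    (hG₁ : ∀ x, ‖fderiv ℝ g x‖ ≤ G₁) (u v : ℝ³) : |g u - g v| ≤ G₁ * ‖u - v‖ := by
  have := Convex.norm_image_sub_le_of_norm_fderiv_le (f := g) (s := univ) (fun x _ => hg x)
    (fun x _ => hG₁ x) convex_univ (mem_univ v) (mem_univ u)
  rwa [Real.norm_eq_abs] at this

/-- A directional derivative is bounded by a Lipschitz constant along the line. [folklore] -/
theorem abs_fderiv_apply_le_of_lipschitz_line {F : ℝ³ → ℝ} {x : ℝ³} (hF : DifferentiableAt ℝ F x)
    (v : ℝ³) {K : ℝ} (hK : 0 ≤ K)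
    (h : ∀ s s' : ℝ, |F (x + s • v) - F (x + s' • v)| ≤ K * |s - s'|) :
    |fderiv ℝ F x v| ≤ K := by
  rw [← hF.lineDeriv_eq_fderiv, lineDeriv]
  have hl : LipschitzWith ⟨K, hK⟩ (fun t : ℝ => F (x + t • v)) := by
    refine LipschitzWith.of_dist_le_mul fun s s' => ?_
    rw [dist_eq_norm, dist_eq_norm, Real.norm_eq_abs, Real.norm_eq_abs]
    exact h s s'
  have := norm_deriv_le_of_lipschitz (x₀ := (0 : ℝ)) hl
  rwa [Real.norm_eq_abs] at this

/-- `|tot| ≤ |b₀ - a₀| sup|g|`. [folklore] -/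
theorem abs_tot_le {G₀ : ℝ} (hG₀ : ∀ x, |g x| ≤ G₀) (x : ℝ³) :
    |tot i a₀ b₀ g x| ≤ |b₀ - a₀| * G₀ := by
  rw [tot, ← Real.norm_eq_abs, mul_comm]
  exact intervalIntegral.norm_integral_le_of_norm_le_const fun t _ => by
    rw [Real.norm_eq_abs]; exact hG₀ _

/-- `|prim| ≤ |xᵢ - a₀| sup|g|`. [folklore] -/
theorem abs_prim_le {G₀ : ℝ} (hG₀ : ∀ x, |g x| ≤ G₀) (x : ℝ³) :
    |prim i a₀ g x| ≤ |x i - a₀| * G₀ := by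
  rw [prim, ← Real.norm_eq_abs, mul_comm]
  exact intervalIntegral.norm_integral_le_of_norm_le_const fun t _ => by
    rw [Real.norm_eq_abs]; exact hG₀ _

/-- Along `eⱼ`, `j ≠ i`, the line integrals move rigidly: Lipschitz estimate for `tot`.
[folklore] -/
theorem abs_tot_sub_tot_le {j : Fin 3} (h : j ≠ i) (hg : Differentiable ℝ g) {G₁ : ℝ}
    (hG₁ : ∀ x, ‖fderiv ℝ g x‖ ≤ G₁) (x : ℝ³) (s s' : ℝ) :
    |tot i a₀ b₀ g (x + s • e j) - tot i a₀ b₀ g (x + s' • e j)| ≤ |b₀ - a₀| * G₁ * |s - s'| := by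
  have hc : ∀ r : ℝ, Continuous fun t => g (lineAt i (x + r • e j) t) := fun r =>
    hg.continuous.comp (continuous_lineAt i _)
  rw [tot, tot, ← intervalIntegral.integral_sub ((hc s).intervalIntegrable _ _)
    ((hc s').intervalIntegrable _ _), ← Real.norm_eq_abs,
    show |b₀ - a₀| * G₁ * |s - s'| = G₁ * |s - s'| * |b₀ - a₀| by ring]
  refine intervalIntegral.norm_integral_le_of_norm_le_const fun t _ => ?_
  rw [Real.norm_eq_abs, lineAt_add_smul_ne h, lineAt_add_smul_ne h]
  refine (abs_sub_le_of_fderiv_bound hg hG₁ _ _).trans (le_of_eq ?_)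
  rw [add_sub_add_left_eq_sub, ← sub_smul, norm_smul, norm_e, mul_one, Real.norm_eq_abs]

/-- Lipschitz estimate for `prim` along `eⱼ`, `j ≠ i`. [folklore] -/
theorem abs_prim_sub_prim_le {j : Fin 3} (h : j ≠ i) (hg : Differentiable ℝ g) {G₁ : ℝ}
    (hG₁ : ∀ x, ‖fderiv ℝ g x‖ ≤ G₁) (x : ℝ³) (s s' : ℝ) :
    |prim i a₀ g (x + s • e j) - prim i a₀ g (x + s' • e j)| ≤ |x i - a₀| * G₁ * |s - s'| := by
  have hc : ∀ r : ℝ, Continuous fun t => g (lineAt i (x + r • e j) t) := fun r =>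
    hg.continuous.comp (continuous_lineAt i _)
  rw [prim, prim, add_smul_e_apply_ne x s h.symm, add_smul_e_apply_ne x s' h.symm,
    ← intervalIntegral.integral_sub ((hc s).intervalIntegrable _ _)
    ((hc s').intervalIntegrable _ _), ← Real.norm_eq_abs,
    show |x i - a₀| * G₁ * |s - s'| = G₁ * |s - s'| * |x i - a₀| by ring]
  refine intervalIntegral.norm_integral_le_of_norm_le_const fun t _ => ?_
  rw [Real.norm_eq_abs, lineAt_add_smul_ne h, lineAt_add_smul_ne h]
  refine (abs_sub_le_of_fderiv_bound hg hG₁ _ _).trans (le_of_eq ?_)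
  rw [add_sub_add_left_eq_sub, ← sub_smul, norm_smul, norm_e, mul_one, Real.norm_eq_abs]

/-- **`|∂ⱼ tot| ≤ |b₀ - a₀| sup‖Dg‖`** for every direction `eⱼ`. [folklore] -/
theorem abs_fderiv_tot_apply_e_le (hg : ContDiff ℝ ∞ g) {G₁ : ℝ} (hG : 0 ≤ G₁)
    (hG₁ : ∀ x, ‖fderiv ℝ g x‖ ≤ G₁) (x : ℝ³) (j : Fin 3) :
    |fderiv ℝ (tot i a₀ b₀ g) x (e j)| ≤ |b₀ - a₀| * G₁ := by
  by_cases h : j = i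
  · subst h
    rw [fderiv_tot_apply_e_self j a₀ b₀ hg x, abs_zero]
    positivity
  · exact abs_fderiv_apply_le_of_lipschitz_line
      ((contDiff_tot i a₀ b₀ hg).differentiable (by simp) x) (e j) (by positivity)
      (abs_tot_sub_tot_le h (hg.differentiable (by simp)) hG₁ x)

/-- **`|∂ⱼ prim| ≤ |xᵢ - a₀| sup‖Dg‖`** for `j ≠ i` (and `∂ᵢ prim = g`). [folklore] -/
theorem abs_fderiv_prim_apply_e_le {j : Fin 3} (h : j ≠ i) (hg : ContDiff ℝ ∞ g) {G₁ : ℝ}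
    (hG : 0 ≤ G₁) (hG₁ : ∀ x, ‖fderiv ℝ g x‖ ≤ G₁) (x : ℝ³) :
    |fderiv ℝ (prim i a₀ g) x (e j)| ≤ |x i - a₀| * G₁ :=
  abs_fderiv_apply_le_of_lipschitz_line ((contDiff_prim i a₀ hg).differentiable (by simp) x)
    (e j) (by positivity) (abs_prim_sub_prim_le h (hg.differentiable (by simp)) hG₁ x)

/-- **`‖D tot‖ ≤ 3 |b₀ - a₀| sup‖Dg‖`.** [folklore] -/
theorem norm_fderiv_tot_le (hg : ContDiff ℝ ∞ g) {G₁ : ℝ} (hG : 0 ≤ G₁)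
    (hG₁ : ∀ x, ‖fderiv ℝ g x‖ ≤ G₁) (x : ℝ³) :
    ‖fderiv ℝ (tot i a₀ b₀ g) x‖ ≤ 3 * (|b₀ - a₀| * G₁) := by
  refine (norm_fderiv_le_sum _ x).trans ?_
  calc ∑ j, |fderiv ℝ (tot i a₀ b₀ g) x (e j)| ≤ ∑ _j : Fin 3, |b₀ - a₀| * G₁ :=
        Finset.sum_le_sum fun j _ => abs_fderiv_tot_apply_e_le hg hG hG₁ x j
    _ = 3 * (|b₀ - a₀| * G₁) := by simp

/-- **`‖D prim‖ ≤ sup|g| + 2 |xᵢ - a₀| sup‖Dg‖`.** [folklore] -/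
theorem norm_fderiv_prim_le (hg : ContDiff ℝ ∞ g) {G₀ G₁ : ℝ} (hG₀ : ∀ x, |g x| ≤ G₀) (hG : 0 ≤ G₁)
    (hG₁ : ∀ x, ‖fderiv ℝ g x‖ ≤ G₁) (x : ℝ³) :
    ‖fderiv ℝ (prim i a₀ g) x‖ ≤ G₀ + 2 * (|x i - a₀| * G₁) := by
  refine (norm_fderiv_le_sum _ x).trans ?_
  have hsplit : ∑ j, |fderiv ℝ (prim i a₀ g) x (e j)| =
      |fderiv ℝ (prim i a₀ g) x (e i)| + ∑ j ∈ Finset.univ.erase i, |fderiv ℝ (prim i a₀ g) x (e j)| :=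
    (Finset.add_sum_erase _ _ (Finset.mem_univ i)).symm
  rw [hsplit, fderiv_prim_apply_e_self i a₀ hg x]
  have hcard : (Finset.univ.erase i).card = 2 := by
    rw [Finset.card_erase_of_mem (Finset.mem_univ i), Finset.card_univ, Fintype.card_fin]
  have hrest : ∑ j ∈ Finset.univ.erase i, |fderiv ℝ (prim i a₀ g) x (e j)| ≤ 2 * (|x i - a₀| * G₁) := by
    calc ∑ j ∈ Finset.univ.erase i, |fderiv ℝ (prim i a₀ g) x (e j)|
        ≤ ∑ _j ∈ Finset.univ.erase i, |x i - a₀| * G₁ := Finset.sum_le_sum fun j hj =>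
          abs_fderiv_prim_apply_e_le (Finset.ne_of_mem_erase hj) hg hG hG₁ x
      _ = 2 * (|x i - a₀| * G₁) := by rw [Finset.sum_const, hcard]; simp
  linarith [hG₀ x]

/-! #### Vanishing of pieces of the line integrals -/

/-- Auxiliary (theorem `prim_eq_zero_of_forall`): prim eq zero of forall. [folklore] -/
theorem prim_eq_zero_of_forall {x : ℝ³} (h : ∀ t ∈ uIoc a₀ (x i), g (lineAt i x t) = 0) :
    prim i a₀ g x = 0 :=
  intervalIntegral.integral_zero_ae (Eventually.of_forall h)

/-- Auxiliary (theorem `tot_eq_zero_of_forall`): tot eq zero of forall. [folklore] -/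
theorem tot_eq_zero_of_forall {x : ℝ³} (h : ∀ t ∈ uIoc a₀ b₀, g (lineAt i x t) = 0) :
    tot i a₀ b₀ g x = 0 :=
  intervalIntegral.integral_zero_ae (Eventually.of_forall h)

/-- If `g` vanishes along the line beyond the height `xᵢ`, the primitive is the full integral.
[folklore] -/
theorem prim_eq_tot_of_forall (hg : Continuous g) {x : ℝ³}
    (h : ∀ t ∈ uIoc (x i) b₀, g (lineAt i x t) = 0) : prim i a₀ g x = tot i a₀ b₀ g x := by
  have hc : Continuous fun t => g (lineAt i x t) := hg.comp (continuous_lineAt i x)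
  rw [prim, tot, ← intervalIntegral.integral_add_adjacent_intervals (a := a₀) (b := x i) (c := b₀)
    (hc.intervalIntegrable _ _) (hc.intervalIntegrable _ _),
    intervalIntegral.integral_zero_ae (Eventually.of_forall h), add_zero]

end Bounds

/-! ### § Fubini: the iterated line integrals compute the integral over `ℝ³` -/

section Fubini

/-- The point with coordinates `(r, s, t)`, written with `lineAt`. [folklore] -/
def pt (r s t : ℝ) : ℝ³ := lineAt 0 (lineAt 1 (lineAt 2 0 t) s) r

/-- Auxiliary (`pt_apply_zero`, simp lemma). [folklore] -/
@[simp] theorem pt_apply_zero (r s t : ℝ) : pt r s t 0 = r := by simp [pt]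

/-- Auxiliary (`pt_apply_one`, simp lemma). [folklore] -/
@[simp] theorem pt_apply_one (r s t : ℝ) : pt r s t 1 = s := by
  simp [pt, lineAt_apply_ne (show (1 : Fin 3) ≠ 0 by decide)]

/-- Auxiliary (`pt_apply_two`, simp lemma). [folklore] -/
@[simp] theorem pt_apply_two (r s t : ℝ) : pt r s t 2 = t := by
  simp [pt, lineAt_apply_ne (show (2 : Fin 3) ≠ 0 by decide),
    lineAt_apply_ne (show (2 : Fin 3) ≠ 1 by decide)]

/-- Auxiliary (theorem `continuous_pt_uncurry`): continuous pt uncurry. [folklore] -/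
theorem continuous_pt_uncurry (t : ℝ) : Continuous fun p : ℝ × ℝ => pt p.1 p.2 t := by
  unfold pt
  have h2 : Continuous fun p : ℝ × ℝ => lineAt 1 (lineAt 2 0 t) p.2 :=
    (continuous_lineAt 1 _).comp continuous_snd
  exact (contDiff_lineAt_uncurry 0).continuous.comp (h2.prodMk continuous_fst)

/-- Every point is `pt` of its coordinates. [folklore] -/
theorem pt_coord (x : ℝ³) : pt (x 0) (x 1) (x 2) = x := by
  ext j
  fin_cases j <;> simp

/-- The measurable equivalence `ℝ³ ≃ᵐ ℝ × (ℝ × ℝ)`, `x ↦ (x₂, (x₀, x₁))`. [folklore] -/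
def split3 : ℝ³ ≃ᵐ ℝ × (ℝ × ℝ) :=
  ((MeasurableEquiv.toLp 2 (Fin 3 → ℝ)).symm.trans
    (MeasurableEquiv.piFinSuccAbove (fun _ => ℝ) 2)).trans
    (MeasurableEquiv.prodCongr (MeasurableEquiv.refl ℝ) MeasurableEquiv.finTwoArrow)

/-- Auxiliary (theorem `split3_apply`): split3 apply. [folklore] -/
theorem split3_apply (x : ℝ³) : split3 x = (x 2, (x 0, x 1)) := rfl

/-- Auxiliary (theorem `split3_symm_apply`): split3 symm apply. [folklore] -/
theorem split3_symm_apply (t r s : ℝ) : split3.symm (t, (r, s)) = pt r s t := by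
  apply split3.injective
  rw [MeasurableEquiv.apply_symm_apply, split3_apply, pt_apply_zero, pt_apply_one, pt_apply_two]

/-- Auxiliary (theorem `measurePreserving_split3`): measurePreserving split3. [folklore] -/
theorem measurePreserving_split3 : MeasurePreserving split3 volume volume := by
  have h1 : MeasurePreserving (MeasurableEquiv.toLp 2 (Fin 3 → ℝ)).symm volume volume :=
    EuclideanSpace.volume_preserving_symm_measurableEquiv_toLp (Fin 3)
  have h2 : MeasurePreserving (MeasurableEquiv.piFinSuccAbove (fun _ : Fin 3 => ℝ) 2) volume
      volume :=
    volume_preserving_piFinSuccAbove (fun _ => ℝ) 2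
  have h3 : MeasurePreserving
      (MeasurableEquiv.prodCongr (MeasurableEquiv.refl ℝ) MeasurableEquiv.finTwoArrow)
      volume volume :=
    (MeasurePreserving.id volume).prod (volume_preserving_finTwoArrow ℝ)
  exact (h1.trans h2).trans h3

/-- **Fubini on `ℝ³`**: `∫ g = ∫ dt ∫ dr ∫ ds g(r, s, t)` for integrable `g`. [folklore] -/
theorem integral_eq_integral_integral_integral {g : ℝ³ → ℝ} (hg : Integrable g) :
    ∫ x, g x = ∫ t : ℝ, ∫ r : ℝ, ∫ s : ℝ, g (pt r s t) := by
  have h1 : ∫ x, g x = ∫ p : ℝ × (ℝ × ℝ), g (split3.symm p) :=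
    ((measurePreserving_split3.symm _).integral_comp split3.symm.measurableEmbedding g).symm
  have hint : Integrable (fun p : ℝ × (ℝ × ℝ) => g (split3.symm p)) :=
    (measurePreserving_split3.symm _).integrable_comp_emb split3.symm.measurableEmbedding |>.2 hg
  rw [h1, Measure.volume_eq_prod]
  rw [Measure.volume_eq_prod] at hint
  rw [integral_prod _ hint]
  refine integral_congr_ae ((hint.prod_right_ae).mono fun t ht => ?_)
  simp only at ht ⊢
  have e1 : (fun q : ℝ × ℝ => g (split3.symm (t, q))) = fun q => g (pt q.1 q.2 t) :=
    funext fun q => by rw [← split3_symm_apply]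
  rw [e1] at ht ⊢
  rw [Measure.volume_eq_prod] at ht ⊢
  exact integral_prod _ ht

/-- The iterated line integral over the cube of half-width `2b` (inner variable `x₀`, then `x₁`,
then `x₂`): `∫_{-2b}^{2b} dt ∫_{-2b}^{2b} ds ∫_{-2b}^{2b} dr g(r, s, t)`. [folklore] -/
def iter (b : ℝ) (g : ℝ³ → ℝ) : ℝ :=
  tot 2 (-(2 * b)) (2 * b) (tot 1 (-(2 * b)) (2 * b) (tot 0 (-(2 * b)) (2 * b) g)) 0

/-- Auxiliary (theorem `iter_eq`): iter eq. [folklore] -/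
theorem iter_eq (b : ℝ) (g : ℝ³ → ℝ) : iter b g =
    ∫ t in (-(2 * b))..(2 * b), ∫ s in (-(2 * b))..(2 * b), ∫ r in (-(2 * b))..(2 * b),
      g (pt r s t) := rfl

variable {g : ℝ³ → ℝ} {b : ℝ}

/-- Auxiliary (theorem `eq_zero_of_abs_gt`): eq zero of abs gt. [folklore] -/
theorem eq_zero_of_abs_gt (hg0 : ∀ x, x ∉ cube b → g x = 0) {x : ℝ³} {i : Fin 3} (h : b < |x i|) :
    g x = 0 :=
  hg0 x fun hx => (not_lt.2 (hx i)) h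

/-- An interval integral over `[-2b, 2b]` of a function vanishing off `[-b, b]` is the integral
over `ℝ`. [folklore] -/
theorem intervalIntegral_eq_integral_of_vanish (hb : 0 < b) {f : ℝ → ℝ}
    (hf : ∀ t, b < |t| → f t = 0) : ∫ t in (-(2 * b))..(2 * b), f t = ∫ t, f t := by
  refine intervalIntegral.integral_eq_integral_of_support_subset fun t ht => ?_
  rw [mem_support] at ht
  by_contra h
  rw [mem_Ioc, not_and_or, not_lt, not_le] at h
  refine ht (hf t ?_)
  rcases h with h | h
  · rw [abs_of_neg (by linarith)]; linarith
  · rw [abs_of_pos (by linarith)]; linarith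

/-- Auxiliary (theorem `hasCompactSupport_of_vanish`): hasCompactSupport of vanish. [folklore] -/
theorem hasCompactSupport_of_vanish (hg0 : ∀ x, x ∉ cube b → g x = 0) : HasCompactSupport g :=
  HasCompactSupport.of_support_subset_isCompact (isCompact_cube b) fun x hx => by
    by_contra h; exact hx (hg0 x h)

/-- **The iterated integral is the integral**, for continuous `g` supported in the cube.
[folklore] -/
theorem iter_eq_integral (hb : 0 < b) (hg : Continuous g) (hg0 : ∀ x, x ∉ cube b → g x = 0) :
    iter b g = ∫ x, g x := by
  have hgc : HasCompactSupport g := hasCompactSupport_of_vanish hg0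
  rw [integral_eq_integral_integral_integral (hg.integrable_of_hasCompactSupport hgc), iter_eq]
  -- vanishing of the integrand off the cube, coordinatewise
  have h0 : ∀ r s t, b < |r| → g (pt r s t) = 0 := fun r s t h =>
    eq_zero_of_abs_gt hg0 (i := 0) (by simpa using h)
  have h1 : ∀ r s t, b < |s| → g (pt r s t) = 0 := fun r s t h =>
    eq_zero_of_abs_gt hg0 (i := 1) (by simpa using h)
  have h2 : ∀ r s t, b < |t| → g (pt r s t) = 0 := fun r s t h =>
    eq_zero_of_abs_gt hg0 (i := 2) (by simpa using h)
  -- swap the two inner integrals (continuous compactly supported slices)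
  have hswap : ∀ t, ∫ r, ∫ s, g (pt r s t) = ∫ s, ∫ r, g (pt r s t) := fun t => by
    refine integral_integral_swap ?_
    refine Continuous.integrable_of_hasCompactSupport (continuous_pt_uncurry t |> hg.comp) ?_
    refine HasCompactSupport.of_support_subset_isCompact
      ((isCompact_Icc (a := -b) (b := b)).prod (isCompact_Icc (a := -b) (b := b))) ?_
    intro q hq
    rw [mem_support] at hq
    simp only [mem_prod, mem_Icc]
    by_contra hc
    rw [not_and_or, not_and_or, not_and_or, not_le, not_le, not_le, not_le] at hc
    rcases hc with (hc | hc) | (hc | hc)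
    · exact hq (h0 _ _ _ (by rw [abs_of_neg (by linarith)]; linarith))
    · exact hq (h0 _ _ _ (by rw [abs_of_pos (by linarith)]; linarith))
    · exact hq (h1 _ _ _ (by rw [abs_of_neg (by linarith)]; linarith))
    · exact hq (h1 _ _ _ (by rw [abs_of_pos (by linarith)]; linarith))
  simp_rw [hswap]
  -- convert to interval integrals, inside out
  have hr : ∀ s t, ∫ r in (-(2 * b))..(2 * b), g (pt r s t) = ∫ r, g (pt r s t) := fun s t =>
    intervalIntegral_eq_integral_of_vanish hb fun r hr => h0 r s t hr
  have hs : ∀ t, ∫ s in (-(2 * b))..(2 * b), ∫ r, g (pt r s t) = ∫ s, ∫ r, g (pt r s t) := fun t =>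
    intervalIntegral_eq_integral_of_vanish hb fun s hs' =>
      integral_eq_zero_of_ae (Eventually.of_forall fun r => h1 r s t hs')
  have ht : ∫ t in (-(2 * b))..(2 * b), ∫ s, ∫ r, g (pt r s t) = ∫ t, ∫ s, ∫ r, g (pt r s t) :=
    intervalIntegral_eq_integral_of_vanish hb fun t ht' =>
      integral_eq_zero_of_ae (Eventually.of_forall fun s =>
        integral_eq_zero_of_ae (Eventually.of_forall fun r => h2 r s t ht'))
  simp_rw [hr, hs, ht]

end Fubini

/-! ### § Linearity and smoothness helpers -/

section Helpers

variable {i : Fin 3} {a₀ b₀ : ℝ}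

/-- Auxiliary (theorem `tot_sub`): tot sub. [folklore] -/
theorem tot_sub {f g : ℝ³ → ℝ} (hf : Continuous f) (hg : Continuous g) (x : ℝ³) :
    tot i a₀ b₀ (fun y => f y - g y) x = tot i a₀ b₀ f x - tot i a₀ b₀ g x := by
  simp only [tot]
  exact intervalIntegral.integral_sub ((hf.comp (continuous_lineAt i x)).intervalIntegrable _ _)
    ((hg.comp (continuous_lineAt i x)).intervalIntegrable _ _)

/-- Auxiliary (theorem `tot_add`): tot add. [folklore] -/
theorem tot_add {f g : ℝ³ → ℝ} (hf : Continuous f) (hg : Continuous g) (x : ℝ³) :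
    tot i a₀ b₀ (fun y => f y + g y) x = tot i a₀ b₀ f x + tot i a₀ b₀ g x := by
  simp only [tot]
  exact intervalIntegral.integral_add ((hf.comp (continuous_lineAt i x)).intervalIntegrable _ _)
    ((hg.comp (continuous_lineAt i x)).intervalIntegrable _ _)

/-- Auxiliary (theorem `tot_const_mul`): tot const mul. [folklore] -/
theorem tot_const_mul (c : ℝ) (f : ℝ³ → ℝ) (x : ℝ³) :
    tot i a₀ b₀ (fun y => c * f y) x = c * tot i a₀ b₀ f x := by
  simp only [tot]
  exact intervalIntegral.integral_const_mul c _

/-- A function of one coordinate: `x ↦ θ (x i)`. Its derivative along `eⱼ`. [folklore] -/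
theorem fderiv_comp_coord_apply_e {θ : ℝ → ℝ} (hθ : Differentiable ℝ θ) (i j : Fin 3) (x : ℝ³) :
    fderiv ℝ (fun y : ℝ³ => θ (y i)) x (e j) = if j = i then deriv θ (x i) else 0 := by
  have hd : DifferentiableAt ℝ (fun y : ℝ³ => θ (y i)) x :=
    (hθ (x i)).comp x ((contDiff_coord (n := 1) i).differentiable (by simp) x)
  rw [← hd.lineDeriv_eq_fderiv]
  by_cases h : j = i
  · subst h
    rw [if_pos rfl]
    have h2 : HasLineDerivAt ℝ (fun y : ℝ³ => θ (y j)) (deriv θ (x j)) x (e j) := by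
      have h3 : HasDerivAt θ (deriv θ (x j)) (x j + 0) := by
        rw [add_zero]; exact (hθ _).hasDerivAt
      have h4 := h3.comp_const_add (x j) 0
      refine HasDerivAt.congr_of_eventuallyEq (by simpa using h4) (Eventually.of_forall fun s => ?_)
      simp only [add_smul_e_apply_same]
    exact h2.lineDeriv
  · rw [if_neg h]
    have h2 : HasLineDerivAt ℝ (fun y : ℝ³ => θ (y i)) 0 x (e j) := by
      refine HasDerivAt.congr_of_eventuallyEq (f := fun _ : ℝ => θ (x i)) (hasDerivAt_const _ _)
        (Eventually.of_forall fun s => ?_)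
      simp only
      rw [add_smul_e_apply_ne x s (Ne.symm h)]
    exact h2.lineDeriv

/-- `‖D(θ ∘ πᵢ)(x)‖ ≤ |θ'(xᵢ)|`. [folklore] -/
theorem norm_fderiv_comp_coord_le {θ : ℝ → ℝ} (hθ : Differentiable ℝ θ) (i : Fin 3) (x : ℝ³) :
    ‖fderiv ℝ (fun y : ℝ³ => θ (y i)) x‖ ≤ |deriv θ (x i)| := by
  refine (norm_fderiv_le_sum _ x).trans (le_of_eq ?_)
  simp only [fderiv_comp_coord_apply_e hθ]
  rw [Fin.sum_univ_three]
  fin_cases i <;> simp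

/-- Auxiliary (theorem `contDiff_comp_coord`): contDiff comp coord. [folklore] -/
theorem contDiff_comp_coord {θ : ℝ → ℝ} {n : ℕ∞} (hθ : ContDiff ℝ n θ) (i : Fin 3) :
    ContDiff ℝ n (fun y : ℝ³ => θ (y i)) :=
  hθ.comp (contDiff_coord i)

/-- Product rule bound `‖D(fh)‖ ≤ |f| ‖Dh‖ + |h| ‖Df‖`. [folklore] -/
theorem norm_fderiv_mul_le {f h : ℝ³ → ℝ} {x : ℝ³} (hf : DifferentiableAt ℝ f x)
    (hh : DifferentiableAt ℝ h x) :
    ‖fderiv ℝ (fun y => f y * h y) x‖ ≤ |f x| * ‖fderiv ℝ h x‖ + |h x| * ‖fderiv ℝ f x‖ := by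
  rw [fderiv_fun_mul hf hh]
  refine (norm_add_le _ _).trans ?_
  rw [norm_smul, norm_smul, Real.norm_eq_abs, Real.norm_eq_abs]

end Helpers

/-! ### § The construction -/

section Construction

variable (a b : ℝ) (g : ℝ³ → ℝ)

/-- The smooth splitting function `σ(x) = Σ(x₀)`, `Σ = 0` for `x₀ ≤ -a/2`, `= 1` for
`x₀ ≥ a/2`. [folklore] -/
def σ (x : ℝ³) : ℝ := step 0 a (x 0)

/-- `g₊ = σ g` (the part of `g` seen from `x₀ > 0`). [folklore] -/
def gp (x : ℝ³) : ℝ := σ a x * g x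

/-- `g₋ = (1 - σ) g`. [folklore] -/
def gm (x : ℝ³) : ℝ := (1 - σ a x) * g x

/-- The bump `θ₊ ∈ C_c^∞((a, b))` of unit mass (support in `[(3a+b)/4, (a+3b)/4]`). [folklore] -/
def θp : ℝ → ℝ := bump ((a + b) / 2) ((b - a) / 2)

/-- The bump `θ₋ ∈ C_c^∞((-b, -a))` of unit mass. [folklore] -/
def θm : ℝ → ℝ := bump (-((a + b) / 2)) ((b - a) / 2)

/-- The primitives `Θ± = ∫ θ±`. [folklore] -/
def Θp : ℝ → ℝ := step ((a + b) / 2) ((b - a) / 2)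

/-- See `Θp`. [folklore] -/
def Θm : ℝ → ℝ := step (-((a + b) / 2)) ((b - a) / 2)

/-- The bump `η = θ₂ ∈ C_c^∞((-b, b))` of unit mass (support in `[-b/2, b/2]`) and its primitive.
[folklore] -/
def η : ℝ → ℝ := bump 0 b

/-- See `η`. [folklore] -/
def Θ₂ : ℝ → ℝ := step 0 b

/-- The planar bump `β(x) = θ₊(x₁) η(x₂)` of unit mass, living in the slab `x₁ ∈ (a, b)`.
[folklore] -/
def β (x : ℝ³) : ℝ := θp a b (x 1) * η b (x 2)

/-- The mass `m = ∫ g₊` (as an iterated integral). [folklore] -/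
def mass : ℝ := iter b (gp a g)

variable {a b g}

/-- One integration stage along `xᵢ` for a piece `h` with step `Θ`:
`x ↦ ∫_{-2b}^{xᵢ} h − Θ(xᵢ) ∫_{-2b}^{2b} h dxᵢ`. [folklore] -/
def stage (i : Fin 3) (b : ℝ) (h : ℝ³ → ℝ) (Θ : ℝ → ℝ) (x : ℝ³) : ℝ :=
  prim i (-(2 * b)) h x - Θ (x i) * tot i (-(2 * b)) (2 * b) h x

/-- The planar remainder `H = ∫ h dx₀ + μ β` (`μ = ∓ m`). [folklore] -/
def H (a b : ℝ) (h : ℝ³ → ℝ) (μ : ℝ) (x : ℝ³) : ℝ :=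
  tot 0 (-(2 * b)) (2 * b) h x + μ * β a b x

/-- Stage 2 along `x₁`: `v₂ = ∫_{-2b}^{x₁} H − Θ₂(x₁) ∫ H dx₁`. [folklore] -/
def v2 (a b : ℝ) (h : ℝ³ → ℝ) (μ : ℝ) : ℝ³ → ℝ := stage 1 b (H a b h μ) (Θ₂ b)

/-- Stage 3 along `x₂`: `v₃ = θ₂(x₁) ∫_{-2b}^{x₂} (∫ H dx₁)`. [folklore] -/
def v3 (a b : ℝ) (h : ℝ³ → ℝ) (μ : ℝ) (x : ℝ³) : ℝ :=
  η b (x 1) * prim 2 (-(2 * b)) (tot 1 (-(2 * b)) (2 * b) (H a b h μ)) x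

variable (a b g)

/-- The `e₀`-component of the corrector. [folklore] -/
def c₀ (x : ℝ³) : ℝ :=
  stage 0 b (gp a g) (Θp a b) x + stage 0 b (gm a g) (Θm a b) x +
    mass a b g * β a b x * (Θp a b (x 0) - Θm a b (x 0))

/-- The `e₁`-component of the corrector. [folklore] -/
def c₁ (x : ℝ³) : ℝ :=
  θp a b (x 0) * v2 a b (gp a g) (-mass a b g) x + θm a b (x 0) * v2 a b (gm a g) (mass a b g) x

/-- The `e₂`-component of the corrector. [folklore] -/
def c₂ (x : ℝ³) : ℝ :=
  θp a b (x 0) * v3 a b (gp a g) (-mass a b g) x + θm a b (x 0) * v3 a b (gm a g) (mass a b g) x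

/-- **The explicit solution `W` of `div W = g`** on the cubical shell. [folklore] -/
def W (x : ℝ³) : ℝ³ := c₀ a b g x • e 0 + c₁ a b g x • e 1 + c₂ a b g x • e 2

/-! #### Smoothness -/

variable {a b g}

/-- Auxiliary (theorem `σ_contDiff`): σ contDiff. [folklore] -/
theorem σ_contDiff : ContDiff ℝ ∞ (σ a) := contDiff_comp_coord (step_contDiff 0 a) 0

/-- Auxiliary (theorem `gp_contDiff`): gp contDiff. [folklore] -/
theorem gp_contDiff (hg : ContDiff ℝ ∞ g) : ContDiff ℝ ∞ (gp a g) := σ_contDiff.mul hg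

/-- Auxiliary (theorem `gm_contDiff`): gm contDiff. [folklore] -/
theorem gm_contDiff (hg : ContDiff ℝ ∞ g) : ContDiff ℝ ∞ (gm a g) :=
  (contDiff_const.sub σ_contDiff).mul hg

/-- Auxiliary (theorem `β_contDiff`): β contDiff. [folklore] -/
theorem β_contDiff : ContDiff ℝ ∞ (β a b) :=
  (contDiff_comp_coord (bump_contDiff _ _) 1).mul (contDiff_comp_coord (bump_contDiff _ _) 2)

/-- Auxiliary (theorem `stage_contDiff`): stage contDiff. [folklore] -/
theorem stage_contDiff {i : Fin 3} {h : ℝ³ → ℝ} {Θ : ℝ → ℝ} (hh : ContDiff ℝ ∞ h)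
    (hΘ : ContDiff ℝ ∞ Θ) : ContDiff ℝ ∞ (stage i b h Θ) :=
  (contDiff_prim i _ hh).sub ((contDiff_comp_coord hΘ i).mul (contDiff_tot i _ _ hh))

/-- Auxiliary (theorem `H_contDiff`): H contDiff. [folklore] -/
theorem H_contDiff {h : ℝ³ → ℝ} (hh : ContDiff ℝ ∞ h) (μ : ℝ) : ContDiff ℝ ∞ (H a b h μ) :=
  (contDiff_tot 0 _ _ hh).add (contDiff_const.mul β_contDiff)

/-- Auxiliary (theorem `v2_contDiff`): v2 contDiff. [folklore] -/
theorem v2_contDiff {h : ℝ³ → ℝ} (hh : ContDiff ℝ ∞ h) (μ : ℝ) : ContDiff ℝ ∞ (v2 a b h μ) :=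
  stage_contDiff (H_contDiff hh μ) (step_contDiff 0 b)

/-- Auxiliary (theorem `v3_contDiff`): v3 contDiff. [folklore] -/
theorem v3_contDiff {h : ℝ³ → ℝ} (hh : ContDiff ℝ ∞ h) (μ : ℝ) : ContDiff ℝ ∞ (v3 a b h μ) :=
  (contDiff_comp_coord (bump_contDiff 0 b) 1).mul
    (contDiff_prim 2 _ (contDiff_tot 1 _ _ (H_contDiff hh μ)))

/-- Auxiliary (theorem `c₀_contDiff`): c₀ contDiff. [folklore] -/
theorem c₀_contDiff (hg : ContDiff ℝ ∞ g) : ContDiff ℝ ∞ (c₀ a b g) :=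
  ((stage_contDiff (gp_contDiff hg) (step_contDiff _ _)).add
    (stage_contDiff (gm_contDiff hg) (step_contDiff _ _))).add
    ((contDiff_const.mul β_contDiff).mul
      ((contDiff_comp_coord (step_contDiff _ _) 0).sub (contDiff_comp_coord (step_contDiff _ _) 0)))

/-- Auxiliary (theorem `c₁_contDiff`): c₁ contDiff. [folklore] -/
theorem c₁_contDiff (hg : ContDiff ℝ ∞ g) : ContDiff ℝ ∞ (c₁ a b g) :=
  ((contDiff_comp_coord (bump_contDiff _ _) 0).mul (v2_contDiff (gp_contDiff hg) _)).add
    ((contDiff_comp_coord (bump_contDiff _ _) 0).mul (v2_contDiff (gm_contDiff hg) _))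

/-- Auxiliary (theorem `c₂_contDiff`): c₂ contDiff. [folklore] -/
theorem c₂_contDiff (hg : ContDiff ℝ ∞ g) : ContDiff ℝ ∞ (c₂ a b g) :=
  ((contDiff_comp_coord (bump_contDiff _ _) 0).mul (v3_contDiff (gp_contDiff hg) _)).add
    ((contDiff_comp_coord (bump_contDiff _ _) 0).mul (v3_contDiff (gm_contDiff hg) _))

/-- Auxiliary (theorem `W_contDiff`): W contDiff. [folklore] -/
theorem W_contDiff (hg : ContDiff ℝ ∞ g) : ContDiff ℝ ∞ (W a b g) :=
  (((c₀_contDiff hg).smul contDiff_const).add ((c₁_contDiff hg).smul contDiff_const)).add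
    ((c₂_contDiff hg).smul contDiff_const)

end Construction

/-! #### The divergence of `W` -/

section Divergence

variable {a b : ℝ} {g : ℝ³ → ℝ}

variable (a b)

/-- Auxiliary (theorem `η_contDiff`): η contDiff. [folklore] -/
theorem η_contDiff {n : ℕ∞} : ContDiff ℝ n (η b) := bump_contDiff _ _
/-- Auxiliary (theorem `θp_contDiff`): θp contDiff. [folklore] -/
theorem θp_contDiff {n : ℕ∞} : ContDiff ℝ n (θp a b) := bump_contDiff _ _
/-- Auxiliary (theorem `θm_contDiff`): θm contDiff. [folklore] -/
theorem θm_contDiff {n : ℕ∞} : ContDiff ℝ n (θm a b) := bump_contDiff _ _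
/-- Auxiliary (theorem `Θp_contDiff`): Θp contDiff. [folklore] -/
theorem Θp_contDiff {n : ℕ∞} : ContDiff ℝ n (Θp a b) := step_contDiff _ _
/-- Auxiliary (theorem `Θm_contDiff`): Θm contDiff. [folklore] -/
theorem Θm_contDiff {n : ℕ∞} : ContDiff ℝ n (Θm a b) := step_contDiff _ _
/-- Auxiliary (theorem `Θ₂_contDiff`): Θ₂ contDiff. [folklore] -/
theorem Θ₂_contDiff {n : ℕ∞} : ContDiff ℝ n (Θ₂ b) := step_contDiff _ _
/-- Auxiliary (theorem `deriv_Θp`): deriv Θp. [folklore] -/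
theorem deriv_Θp : deriv (Θp a b) = θp a b := deriv_step _ _
/-- Auxiliary (theorem `deriv_Θm`): deriv Θm. [folklore] -/
theorem deriv_Θm : deriv (Θm a b) = θm a b := deriv_step _ _
/-- Auxiliary (theorem `deriv_Θ₂`): deriv Θ₂. [folklore] -/
theorem deriv_Θ₂ : deriv (Θ₂ b) = η b := deriv_step _ _

variable {a b}

/-- Differentiability at a point of a `C^∞` function (bookkeeping). [folklore] -/
theorem dAt {F : ℝ³ → ℝ} (hF : ContDiff ℝ ∞ F) (x : ℝ³) : DifferentiableAt ℝ F x :=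
  hF.differentiable (by simp) x

/-- **`∂ᵢ stage = h − Θ'(xᵢ) ∫ h dxᵢ`.** [folklore] -/
theorem fderiv_stage_apply_e_self {i : Fin 3} {h : ℝ³ → ℝ} {Θ : ℝ → ℝ} (hh : ContDiff ℝ ∞ h)
    (hΘ : ContDiff ℝ ∞ Θ) (x : ℝ³) :
    fderiv ℝ (stage i b h Θ) x (e i) = h x - deriv Θ (x i) * tot i (-(2 * b)) (2 * b) h x := by
  have h1 := (dAt (contDiff_prim i (-(2 * b)) hh) x).hasFDerivAt
  have h2 := (dAt (contDiff_comp_coord hΘ i) x).hasFDerivAt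
  have h3 := (dAt (contDiff_tot i (-(2 * b)) (2 * b) hh) x).hasFDerivAt
  have hs : HasFDerivAt (stage i b h Θ) (fderiv ℝ (prim i (-(2 * b)) h) x -
      (Θ (x i) • fderiv ℝ (tot i (-(2 * b)) (2 * b) h) x +
        tot i (-(2 * b)) (2 * b) h x • fderiv ℝ (fun y : ℝ³ => Θ (y i)) x)) x :=
    h1.sub (h2.mul h3)
  rw [hs.fderiv]
  simp only [sub_apply, add_apply, smul_apply, smul_eq_mul, fderiv_prim_apply_e_self i _ hh,
    fderiv_tot_apply_e_self i _ _ hh, fderiv_comp_coord_apply_e (hΘ.differentiable (by simp)),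
    ↓reduceIte]
  ring

/-- A factor depending on another coordinate passes through `∂ₖ`. [folklore] -/
theorem fderiv_comp_coord_mul_apply_e {i k : Fin 3} (hik : k ≠ i) {θ : ℝ → ℝ} {v : ℝ³ → ℝ}
    (hθ : ContDiff ℝ ∞ θ) (hv : ContDiff ℝ ∞ v) (x : ℝ³) :
    fderiv ℝ (fun y => θ (y i) * v y) x (e k) = θ (x i) * fderiv ℝ v x (e k) := by
  have h2 := (dAt (contDiff_comp_coord hθ i) x).hasFDerivAt
  have h3 := (dAt hv x).hasFDerivAt
  have hm : HasFDerivAt (fun y => θ (y i) * v y)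
      (θ (x i) • fderiv ℝ v x + v x • fderiv ℝ (fun y : ℝ³ => θ (y i)) x) x := h2.mul h3
  rw [hm.fderiv]
  simp only [add_apply, smul_apply, smul_eq_mul,
    fderiv_comp_coord_apply_e (hθ.differentiable (by simp)), if_neg hik]
  ring

/-- `β` does not depend on `x₀`. [folklore] -/
theorem β_add_smul_e0 (x : ℝ³) (s : ℝ) : β a b (x + s • e 0) = β a b x := by
  simp only [β, add_smul_e_apply_ne x s (show (1 : Fin 3) ≠ 0 by decide),
    add_smul_e_apply_ne x s (show (2 : Fin 3) ≠ 0 by decide)]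

/-- Auxiliary (theorem `β_lineAt_zero`): β lineAt zero. [folklore] -/
theorem β_lineAt_zero (x : ℝ³) (s : ℝ) : β a b (lineAt 0 x s) = β a b x :=
  β_add_smul_e0 x _

/-- The transfer term and its `∂₀`. [folklore] -/
def transfer (a b : ℝ) (g : ℝ³ → ℝ) (y : ℝ³) : ℝ :=
  mass a b g * β a b y * (Θp a b (y 0) - Θm a b (y 0))

/-- Auxiliary (theorem `transfer_contDiff`): transfer contDiff. [folklore] -/
theorem transfer_contDiff : ContDiff ℝ ∞ (transfer a b g) :=
  (contDiff_const.mul β_contDiff).mul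
    ((contDiff_comp_coord (Θp_contDiff a b) 0).sub (contDiff_comp_coord (Θm_contDiff a b) 0))

/-- Auxiliary (theorem `fderiv_transfer_apply_e0`): fderiv transfer apply e0. [folklore] -/
theorem fderiv_transfer_apply_e0 (x : ℝ³) :
    fderiv ℝ (transfer a b g) x (e 0) = mass a b g * β a b x * (θp a b (x 0) - θm a b (x 0)) := by
  have hΘ : ContDiff ℝ ∞ (fun s => Θp a b s - Θm a b s) := (Θp_contDiff a b).sub (Θm_contDiff a b)
  have hβ := (dAt (contDiff_const.mul β_contDiff : ContDiff ℝ ∞ fun y => mass a b g * β a b y) x)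
    |>.hasFDerivAt
  have hΘ' := (dAt (contDiff_comp_coord hΘ 0) x).hasFDerivAt
  have ht : HasFDerivAt (transfer a b g) _ x := hβ.mul hΘ'
  rw [ht.fderiv]
  simp only [add_apply, smul_apply, smul_eq_mul]
  have h1 : fderiv ℝ (fun y => mass a b g * β a b y) x (e 0) = 0 :=
    fderiv_apply_e_eq_zero_of_invariant (fun y s => by simp only [β_add_smul_e0]) x
  have h2 : fderiv ℝ (fun y : ℝ³ => Θp a b (y 0) - Θm a b (y 0)) x (e 0) =
      θp a b (x 0) - θm a b (x 0) := by
    rw [fderiv_comp_coord_apply_e (θ := fun s => Θp a b s - Θm a b s)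
      (hΘ.differentiable (by simp)), if_pos rfl]
    have d1 : DifferentiableAt ℝ (Θp a b) (x 0) := differentiable_step _ _ _
    have d2 : DifferentiableAt ℝ (Θm a b) (x 0) := differentiable_step _ _ _
    rw [deriv_fun_sub d1 d2, deriv_Θp, deriv_Θm]
  rw [h1, h2]
  ring

/-- Auxiliary (theorem `c₀_eq`): c₀ eq. [folklore] -/
theorem c₀_eq : c₀ a b g = fun x =>
    stage 0 b (gp a g) (Θp a b) x + stage 0 b (gm a g) (Θm a b) x + transfer a b g x := rfl

/-- **`∂₀ c₀`.** [folklore] -/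
theorem fderiv_c₀_apply_e0 (hg : ContDiff ℝ ∞ g) (x : ℝ³) :
    fderiv ℝ (c₀ a b g) x (e 0) =
      (gp a g x - θp a b (x 0) * tot 0 (-(2 * b)) (2 * b) (gp a g) x) +
      (gm a g x - θm a b (x 0) * tot 0 (-(2 * b)) (2 * b) (gm a g) x) +
      mass a b g * β a b x * (θp a b (x 0) - θm a b (x 0)) := by
  have h1 := (dAt (stage_contDiff (b := b) (i := 0) (gp_contDiff (a := a) hg) (Θp_contDiff a b)) x)
    |>.hasFDerivAt
  have h2 := (dAt (stage_contDiff (b := b) (i := 0) (gm_contDiff (a := a) hg) (Θm_contDiff a b)) x)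
    |>.hasFDerivAt
  have h3 := (dAt (transfer_contDiff (a := a) (b := b) (g := g)) x).hasFDerivAt
  have hc : HasFDerivAt (c₀ a b g) (fderiv ℝ (stage 0 b (gp a g) (Θp a b)) x +
      fderiv ℝ (stage 0 b (gm a g) (Θm a b)) x + fderiv ℝ (transfer a b g) x) x := by
    rw [c₀_eq]; exact (h1.add h2).add h3
  rw [hc.fderiv]
  simp only [add_apply]
  rw [fderiv_stage_apply_e_self (gp_contDiff hg) (Θp_contDiff a b),
    fderiv_stage_apply_e_self (gm_contDiff hg) (Θm_contDiff a b), fderiv_transfer_apply_e0,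
    deriv_Θp, deriv_Θm]

/-- Auxiliary (theorem `c₁_eq`): c₁ eq. [folklore] -/
theorem c₁_eq : c₁ a b g = fun x =>
    θp a b (x 0) * v2 a b (gp a g) (-mass a b g) x + θm a b (x 0) * v2 a b (gm a g) (mass a b g) x :=
  rfl

/-- **`∂₁ c₁`.** [folklore] -/
theorem fderiv_c₁_apply_e1 (hg : ContDiff ℝ ∞ g) (x : ℝ³) :
    fderiv ℝ (c₁ a b g) x (e 1) =
      θp a b (x 0) * (H a b (gp a g) (-mass a b g) x -
        η b (x 1) * tot 1 (-(2 * b)) (2 * b) (H a b (gp a g) (-mass a b g)) x) +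
      θm a b (x 0) * (H a b (gm a g) (mass a b g) x -
        η b (x 1) * tot 1 (-(2 * b)) (2 * b) (H a b (gm a g) (mass a b g)) x) := by
  have hv2p := v2_contDiff (a := a) (b := b) (gp_contDiff (a := a) hg) (-mass a b g)
  have hv2m := v2_contDiff (a := a) (b := b) (gm_contDiff (a := a) hg) (mass a b g)
  have h1 := (dAt ((contDiff_comp_coord (θp_contDiff a b) 0).mul hv2p) x).hasFDerivAt
  have h2 := (dAt ((contDiff_comp_coord (θm_contDiff a b) 0).mul hv2m) x).hasFDerivAt
  have hc : HasFDerivAt (c₁ a b g)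
      (fderiv ℝ (fun y => θp a b (y 0) * v2 a b (gp a g) (-mass a b g) y) x +
        fderiv ℝ (fun y => θm a b (y 0) * v2 a b (gm a g) (mass a b g) y) x) x := by
    rw [c₁_eq]; exact h1.add h2
  rw [hc.fderiv]
  simp only [add_apply]
  rw [fderiv_comp_coord_mul_apply_e (show (1 : Fin 3) ≠ 0 by decide) (θp_contDiff a b) hv2p,
    fderiv_comp_coord_mul_apply_e (show (1 : Fin 3) ≠ 0 by decide) (θm_contDiff a b) hv2m]
  unfold v2
  rw [fderiv_stage_apply_e_self (H_contDiff (gp_contDiff hg) _) (Θ₂_contDiff b),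
    fderiv_stage_apply_e_self (H_contDiff (gm_contDiff hg) _) (Θ₂_contDiff b), deriv_Θ₂]

/-- **`∂₂ v₃ = η(x₁) ∫ H dx₁`.** [folklore] -/
theorem fderiv_v3_apply_e2 {h : ℝ³ → ℝ} (hh : ContDiff ℝ ∞ h) (μ : ℝ) (x : ℝ³) :
    fderiv ℝ (v3 a b h μ) x (e 2) = η b (x 1) * tot 1 (-(2 * b)) (2 * b) (H a b h μ) x := by
  unfold v3
  rw [fderiv_comp_coord_mul_apply_e (show (2 : Fin 3) ≠ 1 by decide) (θ := η b) (η_contDiff b)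
    (contDiff_prim 2 _ (contDiff_tot 1 _ _ (H_contDiff hh μ))),
    fderiv_prim_apply_e_self 2 _ (contDiff_tot 1 _ _ (H_contDiff hh μ))]

/-- Auxiliary (theorem `c₂_eq`): c₂ eq. [folklore] -/
theorem c₂_eq : c₂ a b g = fun x =>
    θp a b (x 0) * v3 a b (gp a g) (-mass a b g) x + θm a b (x 0) * v3 a b (gm a g) (mass a b g) x :=
  rfl

/-- **`∂₂ c₂`.** [folklore] -/
theorem fderiv_c₂_apply_e2 (hg : ContDiff ℝ ∞ g) (x : ℝ³) :
    fderiv ℝ (c₂ a b g) x (e 2) =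
      θp a b (x 0) * (η b (x 1) * tot 1 (-(2 * b)) (2 * b) (H a b (gp a g) (-mass a b g)) x) +
      θm a b (x 0) * (η b (x 1) * tot 1 (-(2 * b)) (2 * b) (H a b (gm a g) (mass a b g)) x) := by
  have hv3p := v3_contDiff (a := a) (b := b) (gp_contDiff (a := a) hg) (-mass a b g)
  have hv3m := v3_contDiff (a := a) (b := b) (gm_contDiff (a := a) hg) (mass a b g)
  have h1 := (dAt ((contDiff_comp_coord (θp_contDiff a b) 0).mul hv3p) x).hasFDerivAt
  have h2 := (dAt ((contDiff_comp_coord (θm_contDiff a b) 0).mul hv3m) x).hasFDerivAt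
  have hc : HasFDerivAt (c₂ a b g)
      (fderiv ℝ (fun y => θp a b (y 0) * v3 a b (gp a g) (-mass a b g) y) x +
        fderiv ℝ (fun y => θm a b (y 0) * v3 a b (gm a g) (mass a b g) y) x) x := by
    rw [c₂_eq]; exact h1.add h2
  rw [hc.fderiv]
  simp only [add_apply]
  rw [fderiv_comp_coord_mul_apply_e (show (2 : Fin 3) ≠ 0 by decide) (θp_contDiff a b) hv3p,
    fderiv_comp_coord_mul_apply_e (show (2 : Fin 3) ≠ 0 by decide) (θm_contDiff a b) hv3m,
    fderiv_v3_apply_e2 (gp_contDiff hg), fderiv_v3_apply_e2 (gm_contDiff hg)]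

/-- The divergence of a field given by its three components. [folklore] -/
theorem divergence_components {c₀' c₁' c₂' : ℝ³ → ℝ} {x : ℝ³} (h₀ : DifferentiableAt ℝ c₀' x)
    (h₁ : DifferentiableAt ℝ c₁' x) (h₂ : DifferentiableAt ℝ c₂' x) :
    VectorCalculus.divergence (fun y => c₀' y • e 0 + c₁' y • e 1 + c₂' y • e 2) x =
      fderiv ℝ c₀' x (e 0) + fderiv ℝ c₁' x (e 1) + fderiv ℝ c₂' x (e 2) := by
  rw [divergence_eq_sum_inner_fderiv (EuclideanSpace.basisFun (Fin 3) ℝ)]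
  have hW : HasFDerivAt (fun y => c₀' y • e 0 + c₁' y • e 1 + c₂' y • e 2)
      ((fderiv ℝ c₀' x).smulRight (e 0) + (fderiv ℝ c₁' x).smulRight (e 1) +
        (fderiv ℝ c₂' x).smulRight (e 2)) x :=
    ((h₀.hasFDerivAt.smul_const (e 0)).add (h₁.hasFDerivAt.smul_const (e 1))).add
      (h₂.hasFDerivAt.smul_const (e 2))
  simp only [hW.fderiv, basisFun_eq_e, Fin.sum_univ_three, add_apply,
    ContinuousLinearMap.smulRight_apply, inner_add_right, inner_smul_right, inner_e_left, e_apply]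
  simp

/-- **`div W = g`.** [folklore] -/
theorem divergence_W (hg : ContDiff ℝ ∞ g) (x : ℝ³) : VectorCalculus.divergence (W a b g) x = g x := by
  have hdiv := divergence_components (x := x) (dAt (c₀_contDiff (a := a) (b := b) hg) x)
    (dAt (c₁_contDiff (a := a) (b := b) hg) x) (dAt (c₂_contDiff (a := a) (b := b) hg) x)
  rw [show W a b g = fun y => c₀ a b g y • e 0 + c₁ a b g y • e 1 + c₂ a b g y • e 2 from rfl, hdiv,
    fderiv_c₀_apply_e0 hg, fderiv_c₁_apply_e1 hg, fderiv_c₂_apply_e2 hg]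
  simp only [H, gp, gm]
  ring

end Divergence

/-! #### The support of `W` -/

section Support

variable {a b : ℝ} {g h : ℝ³ → ℝ} {μ : ℝ}

/-- Auxiliary (theorem `θp_eq_zero_of_le`): θp eq zero of le. [folklore] -/
theorem θp_eq_zero_of_le (hab : a < b) {t : ℝ} (ht : t ≤ a) : θp a b t = 0 :=
  bump_eq_zero_of_le (by linarith) (by linarith)

/-- Auxiliary (theorem `θp_eq_zero_of_ge`): θp eq zero of ge. [folklore] -/
theorem θp_eq_zero_of_ge (hab : a < b) {t : ℝ} (ht : b ≤ t) : θp a b t = 0 :=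
  bump_eq_zero_of_ge (by linarith) (by linarith)

/-- Auxiliary (theorem `θp_eq_zero_of_abs_le`): θp eq zero of abs le. [folklore] -/
theorem θp_eq_zero_of_abs_le (hab : a < b) {t : ℝ} (ht : |t| ≤ a) : θp a b t = 0 :=
  θp_eq_zero_of_le hab ((le_abs_self t).trans ht)

/-- Auxiliary (theorem `θp_eq_zero_of_abs_ge`): θp eq zero of abs ge. [folklore] -/
theorem θp_eq_zero_of_abs_ge (ha : 0 < a) (hab : a < b) {t : ℝ} (ht : b ≤ |t|) : θp a b t = 0 := by
  rcases le_abs'.1 ht with h | h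
  · exact θp_eq_zero_of_le hab (by linarith)
  · exact θp_eq_zero_of_ge hab h

/-- Auxiliary (theorem `θm_eq_zero_of_ge`): θm eq zero of ge. [folklore] -/
theorem θm_eq_zero_of_ge (hab : a < b) {t : ℝ} (ht : -a ≤ t) : θm a b t = 0 :=
  bump_eq_zero_of_ge (by linarith) (by linarith)

/-- Auxiliary (theorem `θm_eq_zero_of_le`): θm eq zero of le. [folklore] -/
theorem θm_eq_zero_of_le (hab : a < b) {t : ℝ} (ht : t ≤ -b) : θm a b t = 0 :=
  bump_eq_zero_of_le (by linarith) (by linarith)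

/-- Auxiliary (theorem `θm_eq_zero_of_abs_le`): θm eq zero of abs le. [folklore] -/
theorem θm_eq_zero_of_abs_le (hab : a < b) {t : ℝ} (ht : |t| ≤ a) : θm a b t = 0 :=
  θm_eq_zero_of_ge hab (by linarith [neg_abs_le t])

/-- Auxiliary (theorem `θm_eq_zero_of_abs_ge`): θm eq zero of abs ge. [folklore] -/
theorem θm_eq_zero_of_abs_ge (ha : 0 < a) (hab : a < b) {t : ℝ} (ht : b ≤ |t|) : θm a b t = 0 := by
  rcases le_abs'.1 ht with h | h
  · exact θm_eq_zero_of_le hab h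
  · exact θm_eq_zero_of_ge hab (by linarith)

/-- Auxiliary (theorem `Θp_eq_zero_of_le`): Θp eq zero of le. [folklore] -/
theorem Θp_eq_zero_of_le (hab : a < b) {t : ℝ} (ht : t ≤ a) : Θp a b t = 0 :=
  step_eq_zero (by linarith) (by linarith)

/-- Auxiliary (theorem `Θp_eq_one_of_ge`): Θp eq one of ge. [folklore] -/
theorem Θp_eq_one_of_ge (hab : a < b) {t : ℝ} (ht : b ≤ t) : Θp a b t = 1 :=
  step_eq_one (by linarith) (by linarith)

/-- Auxiliary (theorem `Θm_eq_zero_of_le`): Θm eq zero of le. [folklore] -/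
theorem Θm_eq_zero_of_le (hab : a < b) {t : ℝ} (ht : t ≤ -b) : Θm a b t = 0 :=
  step_eq_zero (by linarith) (by linarith)

/-- Auxiliary (theorem `Θm_eq_one_of_ge`): Θm eq one of ge. [folklore] -/
theorem Θm_eq_one_of_ge (hab : a < b) {t : ℝ} (ht : -a ≤ t) : Θm a b t = 1 :=
  step_eq_one (by linarith) (by linarith)

/-- Auxiliary (theorem `η_eq_zero_of_abs_ge`): η eq zero of abs ge. [folklore] -/
theorem η_eq_zero_of_abs_ge (hb : 0 < b) {t : ℝ} (ht : b ≤ |t|) : η b t = 0 :=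
  bump_eq_zero hb (by rw [sub_zero]; linarith)

/-- Auxiliary (theorem `Θ₂_eq_zero_of_le`): Θ₂ eq zero of le. [folklore] -/
theorem Θ₂_eq_zero_of_le (hb : 0 < b) {t : ℝ} (ht : t ≤ -b) : Θ₂ b t = 0 :=
  step_eq_zero hb (by linarith)

/-- Auxiliary (theorem `Θ₂_eq_one_of_ge`): Θ₂ eq one of ge. [folklore] -/
theorem Θ₂_eq_one_of_ge (hb : 0 < b) {t : ℝ} (ht : b ≤ t) : Θ₂ b t = 1 :=
  step_eq_one hb (by linarith)

/-- Auxiliary (theorem `σ_eq_zero`): σ eq zero. [folklore] -/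
theorem σ_eq_zero (ha : 0 < a) {y : ℝ³} (hy : y 0 ≤ -(a / 2)) : σ a y = 0 :=
  step_eq_zero ha (by linarith)

/-- Auxiliary (theorem `σ_eq_one`): σ eq one. [folklore] -/
theorem σ_eq_one (ha : 0 < a) {y : ℝ³} (hy : a / 2 ≤ y 0) : σ a y = 1 :=
  step_eq_one ha (by linarith)

/-- Auxiliary (theorem `notMem_shell_of_abs_gt`): notMem shell of abs gt. [folklore] -/
theorem notMem_shell_of_abs_gt {y : ℝ³} {j : Fin 3} (hy : b < |y j|) : y ∉ shell a b :=
  fun hm => (not_lt.2 (hm.2 j)) hy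

/-- Auxiliary (theorem `notMem_shell_of_forall_abs_lt`): notMem shell of forall abs lt. [folklore] -/
theorem notMem_shell_of_forall_abs_lt {y : ℝ³} (hy : ∀ j, |y j| < a) : y ∉ shell a b :=
  fun hm => by obtain ⟨j, hj⟩ := hm.1; exact (not_lt.2 hj) (hy j)

/-- Auxiliary (theorem `β_eq_zero_of_abs_one_le`): β eq zero of abs one le. [folklore] -/
theorem β_eq_zero_of_abs_one_le (hab : a < b) {y : ℝ³} (hy : |y 1| ≤ a) : β a b y = 0 := by
  rw [β, θp_eq_zero_of_abs_le hab hy, zero_mul]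

/-- Auxiliary (theorem `β_eq_zero_of_abs_one_ge`): β eq zero of abs one ge. [folklore] -/
theorem β_eq_zero_of_abs_one_ge (ha : 0 < a) (hab : a < b) {y : ℝ³} (hy : b ≤ |y 1|) : β a b y = 0 := by
  rw [β, θp_eq_zero_of_abs_ge ha hab hy, zero_mul]

/-- Auxiliary (theorem `β_eq_zero_of_abs_two_ge`): β eq zero of abs two ge. [folklore] -/
theorem β_eq_zero_of_abs_two_ge (hb : 0 < b) {y : ℝ³} (hy : b ≤ |y 2|) : β a b y = 0 := by
  rw [β, η_eq_zero_of_abs_ge hb hy, mul_zero]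

/-- A piece `k g` of `g` vanishes on every `x₀`-line through a point with another coordinate
beyond `b`. [folklore] -/
theorem line0_eq_zero (hg0 : ∀ x, x ∉ shell a b → g x = 0) (k : ℝ³ → ℝ) {y : ℝ³} {j : Fin 3}
    (hj : j ≠ 0) (hy : b < |y j|) (t : ℝ) : k (lineAt 0 y t) * g (lineAt 0 y t) = 0 := by
  rw [hg0 _ (notMem_shell_of_abs_gt (j := j) (by rwa [lineAt_apply_ne hj])), mul_zero]

/-- Auxiliary (theorem `tot0_eq_zero`): tot0 eq zero. [folklore] -/
theorem tot0_eq_zero (hg0 : ∀ x, x ∉ shell a b → g x = 0) (k : ℝ³ → ℝ) {y : ℝ³} {j : Fin 3}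
    (hj : j ≠ 0) (hy : b < |y j|) : tot 0 (-(2 * b)) (2 * b) (fun z => k z * g z) y = 0 :=
  tot_eq_zero_of_forall fun t _ => line0_eq_zero hg0 k hj hy t

/-- Auxiliary (theorem `prim0_eq_zero`): prim0 eq zero. [folklore] -/
theorem prim0_eq_zero (hg0 : ∀ x, x ∉ shell a b → g x = 0) (k : ℝ³ → ℝ) {y : ℝ³} {j : Fin 3}
    (hj : j ≠ 0) (hy : b < |y j|) : prim 0 (-(2 * b)) (fun z => k z * g z) y = 0 :=
  prim_eq_zero_of_forall fun t _ => line0_eq_zero hg0 k hj hy t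

/-- `H` vanishes at points whose coordinate `x₂` is beyond `b`. [folklore] -/
theorem H_eq_zero_of_abs_two (hb : 0 < b) (hg0 : ∀ x, x ∉ shell a b → g x = 0) (k : ℝ³ → ℝ)
    {y : ℝ³} (hy : b < |y 2|) : H a b (fun z => k z * g z) μ y = 0 := by
  rw [H, tot0_eq_zero hg0 k (by decide) hy, β_eq_zero_of_abs_two_ge hb hy.le]; ring

/-- `H` vanishes along `x₁`-lines at heights `|t| > b`. [folklore] -/
theorem H_lineAt_one_eq_zero (ha : 0 < a) (hab : a < b) (hg0 : ∀ x, x ∉ shell a b → g x = 0)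
    (k : ℝ³ → ℝ) (x : ℝ³) {t : ℝ} (ht : b < |t|) :
    H a b (fun z => k z * g z) μ (lineAt 1 x t) = 0 := by
  rw [H, tot0_eq_zero hg0 k (j := 1) (by decide) (by simpa using ht),
    β_eq_zero_of_abs_one_ge ha hab (by simpa using ht.le)]
  ring

end Support

/-! #### Closing of the last primitive: iterated totals -/

section Totals

variable {a b : ℝ} {g h : ℝ³ → ℝ} {μ : ℝ}

/-- The triple total does not depend on the base point. [folklore] -/
theorem tot_tot_tot_const (h : ℝ³ → ℝ) (x : ℝ³) :
    tot 2 (-(2 * b)) (2 * b) (tot 1 (-(2 * b)) (2 * b) (tot 0 (-(2 * b)) (2 * b) h)) x = iter b h := by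
  set F₀ := tot 0 (-(2 * b)) (2 * b) h with hF₀
  set F₁ := tot 1 (-(2 * b)) (2 * b) F₀ with hF₁
  set F₂ := tot 2 (-(2 * b)) (2 * b) F₁ with hF₂
  have i00 : ∀ y s, F₀ (lineAt 0 y s) = F₀ y := fun y s => tot_lineAt 0 _ _ h y s
  have i11 : ∀ y s, F₁ (lineAt 1 y s) = F₁ y := fun y s => tot_lineAt 1 _ _ F₀ y s
  have i10 : ∀ y s, F₁ (lineAt 0 y s) = F₁ y := fun y s =>
    tot_lineAt_of_invariant (by decide) i00 y s
  have i22 : ∀ y s, F₂ (lineAt 2 y s) = F₂ y := fun y s => tot_lineAt 2 _ _ F₁ y s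
  have i21 : ∀ y s, F₂ (lineAt 1 y s) = F₂ y := fun y s =>
    tot_lineAt_of_invariant (by decide) i11 y s
  have i20 : ∀ y s, F₂ (lineAt 0 y s) = F₂ y := fun y s =>
    tot_lineAt_of_invariant (by decide) i10 y s
  change F₂ x = F₂ 0
  conv_lhs => rw [← pt_coord x]
  rw [pt, i20, i21, i22]

/-- Auxiliary (theorem `tot1_β`): tot1 β. [folklore] -/
theorem tot1_β (ha : 0 < a) (hab : a < b) (y : ℝ³) :
    tot 1 (-(2 * b)) (2 * b) (β a b) y = η b (y 2) := by
  simp only [tot, β, lineAt_apply_same, lineAt_apply_ne (show (2 : Fin 3) ≠ 1 by decide)]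
  rw [intervalIntegral.integral_mul_const, intervalIntegral_eq_integral_of_vanish (by linarith)
    (fun t ht => θp_eq_zero_of_abs_ge ha hab ht.le)]
  rw [θp, integral_bump (by linarith), one_mul]

/-- Auxiliary (theorem `tot2_η`): tot2 η. [folklore] -/
theorem tot2_η (hb : 0 < b) (x : ℝ³) : tot 2 (-(2 * b)) (2 * b) (fun y : ℝ³ => η b (y 2)) x = 1 := by
  simp only [tot, lineAt_apply_same]
  rw [intervalIntegral_eq_integral_of_vanish hb (fun t ht => η_eq_zero_of_abs_ge hb ht.le), η,
    integral_bump hb]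

/-- The total of `H` along `x₁` and `x₂`: `iter h + μ`. [folklore] -/
theorem tot2_tot1_H (ha : 0 < a) (hab : a < b) (hh : Continuous h) (x : ℝ³) :
    tot 2 (-(2 * b)) (2 * b) (tot 1 (-(2 * b)) (2 * b) (H a b h μ)) x = iter b h + μ := by
  have hb : 0 < b := ha.trans hab
  have hF₀ : Continuous (tot 0 (-(2 * b)) (2 * b) h) := continuous_tot 0 _ _ hh
  have hβc : Continuous (β a b) := (β_contDiff (a := a) (b := b)).continuous
  have h1 : tot 1 (-(2 * b)) (2 * b) (H a b h μ) =
      fun y => tot 1 (-(2 * b)) (2 * b) (tot 0 (-(2 * b)) (2 * b) h) y + μ * η b (y 2) := by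
    funext y
    have hc : Continuous fun z => μ * β a b z := continuous_const.mul hβc
    rw [show H a b h μ = fun z => tot 0 (-(2 * b)) (2 * b) h z + (fun z => μ * β a b z) z from rfl,
      tot_add hF₀ hc, tot_const_mul, tot1_β ha hab]
  have hc' : Continuous fun y : ℝ³ => μ * η b (y 2) :=
    continuous_const.mul ((continuous_bump 0 b).comp (continuous_coord 2))
  rw [h1, tot_add (continuous_tot 1 _ _ hF₀) hc', tot_tot_tot_const, tot_const_mul,
    tot2_η hb, mul_one]

/-- The iterated integral is additive on the splitting `g = g₊ + g₋`. [folklore] -/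
theorem iter_gp_add_iter_gm (hb : 0 < b) (hg : Continuous g)
    (hg0 : ∀ x, x ∉ shell a b → g x = 0) :
    iter b (gp a g) + iter b (gm a g) = iter b g := by
  have hgc0 : ∀ x, x ∉ cube b → g x = 0 := fun x hx => hg0 x fun h => hx (shell_subset_cube a b h)
  have hσ : Continuous (σ a) := (σ_contDiff (a := a)).continuous
  have hp : Continuous (gp a g) := hσ.mul hg
  have hm : Continuous (gm a g) := (continuous_const.sub hσ).mul hg
  have hp0 : ∀ x, x ∉ cube b → gp a g x = 0 := fun x hx => by rw [gp, hgc0 x hx, mul_zero]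
  have hm0 : ∀ x, x ∉ cube b → gm a g x = 0 := fun x hx => by rw [gm, hgc0 x hx, mul_zero]
  rw [iter_eq_integral hb hp hp0, iter_eq_integral hb hm hm0, iter_eq_integral hb hg hgc0,
    ← integral_add (hp.integrable_of_hasCompactSupport (hasCompactSupport_of_vanish hp0))
    (hm.integrable_of_hasCompactSupport (hasCompactSupport_of_vanish hm0))]
  refine integral_congr_ae (Eventually.of_forall fun x => ?_)
  simp only [gp, gm]; ring

end Totals

/-! #### `W` vanishes off the shell -/

section Vanishing

variable {a b : ℝ} {g : ℝ³ → ℝ}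

/-- A stage vanishes when its input vanishes along the whole line. [folklore] -/
theorem stage_eq_zero_of_line_zero {i : Fin 3} {F : ℝ³ → ℝ} (Θ : ℝ → ℝ) {x : ℝ³}
    (h : ∀ t, F (lineAt i x t) = 0) : stage i b F Θ x = 0 := by
  unfold stage
  rw [prim_eq_zero_of_forall fun t _ => h t, tot_eq_zero_of_forall fun t _ => h t, mul_zero, sub_zero]

/-- A stage vanishes at points with `|xᵢ| > b` when its input vanishes along the line at heights
`|t| > b` and the step is `0` below `-b` and `1` above `b`. [folklore] -/
theorem stage_eq_zero_of_abs_self (hb : 0 < b) {i : Fin 3} {F : ℝ³ → ℝ} (hF : Continuous F)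
    {Θ : ℝ → ℝ} (hΘ0 : ∀ t, t ≤ -b → Θ t = 0) (hΘ1 : ∀ t, b ≤ t → Θ t = 1) {x : ℝ³}
    (hline : ∀ t, b < |t| → F (lineAt i x t) = 0) (hx : b < |x i|) : stage i b F Θ x = 0 := by
  unfold stage
  rcases lt_abs.1 hx with h | h
  · rw [hΘ1 _ h.le, one_mul, prim_eq_tot_of_forall (b₀ := 2 * b) hF, sub_self]
    intro t ht
    refine hline t ?_
    have : b < t := by
      rcases mem_uIoc.1 ht with ⟨h1, _⟩ | ⟨h1, _⟩
      · exact h.trans h1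
      · linarith
    rwa [abs_of_pos (hb.trans this)]
  · have hx' : x i < -b := by linarith
    rw [hΘ0 _ hx'.le, zero_mul, sub_zero]
    refine prim_eq_zero_of_forall fun t ht => hline t ?_
    have : t < -b := by
      rcases mem_uIoc.1 ht with ⟨_, h2⟩ | ⟨_, h2⟩
      · exact lt_of_le_of_lt h2 hx'
      · linarith
    rw [abs_of_neg (by linarith)]; linarith

/-- Auxiliary (theorem `fin3_cases`): fin3 cases. [folklore] -/
theorem fin3_cases (j : Fin 3) : j = 0 ∨ j = 1 ∨ j = 2 := by fin_cases j <;> simp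

/-- The hypotheses on the datum `g`. [folklore] -/
structure Datum (a b : ℝ) (g : ℝ³ → ℝ) : Prop where
  /-- Field `ha`. -/
  ha : 0 < a
  /-- Field `hab`. -/
  hab : a < b
  /-- Field `smooth`. -/
  smooth : ContDiff ℝ ∞ g
  /-- Field `vanish`. -/
  vanish : ∀ x, x ∉ shell a b → g x = 0
  /-- Field `integral_zero`. -/
  integral_zero : ∫ x, g x = 0

namespace Datum

variable (d : Datum a b g)
include d

/-- Auxiliary (theorem `hb`): hb. [folklore] -/
theorem hb : 0 < b := d.ha.trans d.hab

/-- Auxiliary (theorem `continuous`): continuous. [folklore] -/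
theorem continuous : Continuous g := d.smooth.continuous

/-- Auxiliary (theorem `continuous_gp`): continuous gp. [folklore] -/
theorem continuous_gp : Continuous (gp a g) := (σ_contDiff (a := a)).continuous.mul d.continuous

/-- Auxiliary (theorem `continuous_gm`): continuous gm. [folklore] -/
theorem continuous_gm : Continuous (gm a g) :=
  (continuous_const.sub (σ_contDiff (a := a)).continuous).mul d.continuous

/-- Auxiliary (theorem `iter_zero`): iter zero. [folklore] -/
theorem iter_zero : iter b g = 0 := by
  rw [iter_eq_integral d.hb d.continuous (fun x hx => d.vanish x fun h => hx (shell_subset_cube a b h)),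
    d.integral_zero]

omit d in
/-- Auxiliary (theorem `closing_gp`): closing gp. [folklore] -/
theorem closing_gp : iter b (gp a g) + -mass a b g = 0 := by rw [mass]; ring

/-- Auxiliary (theorem `closing_gm`): closing gm. [folklore] -/
theorem closing_gm : iter b (gm a g) + mass a b g = 0 := by
  rw [mass, add_comm, iter_gp_add_iter_gm d.hb d.continuous d.vanish, d.iter_zero]

/-- In the hole, the `+` stage vanishes. [folklore] -/
theorem stage0_gp_eq_zero_of_hole {x : ℝ³} (hx : ∀ j, |x j| < a) :
    stage 0 b (gp a g) (Θp a b) x = 0 := by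
  unfold stage
  have hx0 : x 0 < a := (le_abs_self _).trans_lt (hx 0)
  rw [Θp_eq_zero_of_le d.hab hx0.le, zero_mul, sub_zero]
  refine prim_eq_zero_of_forall fun t ht => ?_
  have hlt : -(2 * b) < x 0 := by
    have := neg_abs_le (x 0); linarith [hx 0, d.hab, d.ha]
  rw [uIoc_of_le hlt.le] at ht
  by_cases h : t ≤ -(a / 2)
  · rw [gp, σ_eq_zero d.ha (by simpa using h), zero_mul]
  · rw [gp, d.vanish _ (notMem_shell_of_forall_abs_lt fun j => ?_), mul_zero]
    by_cases hj : j = 0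
    · subst hj
      rw [lineAt_apply_same, abs_lt]
      constructor <;> linarith [ht.2]
    · rw [lineAt_apply_ne hj]; exact hx j

/-- In the hole, the `−` stage vanishes. [folklore] -/
theorem stage0_gm_eq_zero_of_hole {x : ℝ³} (hx : ∀ j, |x j| < a) :
    stage 0 b (gm a g) (Θm a b) x = 0 := by
  unfold stage
  have hx0 : -a < x 0 := by have := neg_abs_le (x 0); linarith [hx 0]
  rw [Θm_eq_one_of_ge d.hab hx0.le, one_mul, prim_eq_tot_of_forall (b₀ := 2 * b) d.continuous_gm,
    sub_self]
  intro t ht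
  have hlt : x 0 ≤ 2 * b := by linarith [le_abs_self (x 0), hx 0, d.hab, d.ha]
  rw [uIoc_of_le hlt] at ht
  change (1 - σ a (lineAt 0 x t)) * g (lineAt 0 x t) = 0
  by_cases h : a / 2 ≤ t
  · rw [σ_eq_one d.ha (by simpa using h), sub_self, zero_mul]
  · rw [d.vanish _ (notMem_shell_of_forall_abs_lt fun j => ?_), mul_zero]
    by_cases hj : j = 0
    · subst hj
      rw [lineAt_apply_same, abs_lt]
      constructor <;> linarith [ht.1]
    · rw [lineAt_apply_ne hj]; exact hx j

/-- A piece `k g` vanishes along the `x₀`-line at heights `|t| > b`. [folklore] -/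
theorem piece_line0_eq_zero (k : ℝ³ → ℝ) (x : ℝ³) {t : ℝ} (ht : b < |t|) :
    k (lineAt 0 x t) * g (lineAt 0 x t) = 0 := by
  rw [d.vanish _ (notMem_shell_of_abs_gt (j := 0) (by simpa using ht)), mul_zero]

/-- **`c₀ = 0` off the shell.** [folklore] -/
theorem c₀_eq_zero {x : ℝ³} (hx : x ∉ shell a b) : c₀ a b g x = 0 := by
  rw [c₀_eq]
  simp only [transfer]
  rcases not_mem_shell.1 hx with h | ⟨j, hj⟩
  · rw [d.stage0_gp_eq_zero_of_hole h, d.stage0_gm_eq_zero_of_hole h,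
      β_eq_zero_of_abs_one_le d.hab (h 1).le]
    ring
  · have hβ0 : β a b x = 0 ∨ (Θp a b (x 0) - Θm a b (x 0)) = 0 := by
      rcases fin3_cases j with rfl | rfl | rfl
      · right
        rcases le_abs'.1 hj.le with h' | h'
        · rw [Θp_eq_zero_of_le d.hab (by linarith [d.ha, d.hb]), Θm_eq_zero_of_le d.hab h',
            sub_zero]
        · rw [Θp_eq_one_of_ge d.hab h', Θm_eq_one_of_ge d.hab (by linarith [d.ha, d.hb]), sub_self]
      · left; exact β_eq_zero_of_abs_one_ge d.ha d.hab hj.le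
      · left; exact β_eq_zero_of_abs_two_ge d.hb hj.le
    have hst : stage 0 b (gp a g) (Θp a b) x = 0 ∧ stage 0 b (gm a g) (Θm a b) x = 0 := by
      by_cases hj0 : j = 0
      · subst hj0
        exact ⟨stage_eq_zero_of_abs_self d.hb d.continuous_gp
            (fun t ht => Θp_eq_zero_of_le d.hab (by linarith [d.ha, d.hb]))
            (fun t ht => Θp_eq_one_of_ge d.hab ht) (fun t ht => d.piece_line0_eq_zero (σ a) x ht) hj,
          stage_eq_zero_of_abs_self d.hb d.continuous_gm
            (fun t ht => Θm_eq_zero_of_le d.hab ht)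
            (fun t ht => Θm_eq_one_of_ge d.hab (by linarith [d.ha, d.hb]))
            (fun t ht => d.piece_line0_eq_zero (fun z => 1 - σ a z) x ht) hj⟩
      · exact ⟨stage_eq_zero_of_line_zero _ fun t => line0_eq_zero d.vanish (σ a) hj0 hj t,
          stage_eq_zero_of_line_zero _ fun t => line0_eq_zero d.vanish (fun z => 1 - σ a z) hj0 hj t⟩
    rw [hst.1, hst.2]
    rcases hβ0 with h0 | h0 <;> rw [h0] <;> ring

/-- `v₂` vanishes at points with `|x₁| > b` or `|x₂| > b`, for any continuous piece `k g`.
[folklore] -/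
theorem v2_eq_zero {k : ℝ³ → ℝ} (hk : Continuous k) (μ : ℝ) {x : ℝ³} {j : Fin 3} (hj : j ≠ 0)
    (hx : b < |x j|) : v2 a b (fun z => k z * g z) μ x = 0 := by
  have hHc : Continuous (H a b (fun z => k z * g z) μ) :=
    (continuous_tot 0 _ _ (hk.mul d.continuous)).add
      (continuous_const.mul (β_contDiff (a := a) (b := b)).continuous)
  unfold v2
  have hj' : j = 1 ∨ j = 2 := by
    rcases fin3_cases j with rfl | h
    · exact absurd rfl hj
    · exact h
  rcases hj' with rfl | rfl
  · exact stage_eq_zero_of_abs_self d.hb hHc (fun t ht => Θ₂_eq_zero_of_le d.hb ht)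
      (fun t ht => Θ₂_eq_one_of_ge d.hb ht)
      (fun t ht => H_lineAt_one_eq_zero d.ha d.hab d.vanish k x ht) hx
  · exact stage_eq_zero_of_line_zero _ fun t =>
      H_eq_zero_of_abs_two d.hb d.vanish k (by
        rwa [lineAt_apply_ne (show (2 : Fin 3) ≠ 1 by decide)])

/-- `v₃` vanishes at points with `|x₁| > b`. [folklore] -/
theorem v3_eq_zero_of_abs_one (h : ℝ³ → ℝ) (μ : ℝ) {x : ℝ³} (hx : b < |x 1|) :
    v3 a b h μ x = 0 := by
  rw [v3, η_eq_zero_of_abs_ge d.hb hx.le, zero_mul]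

/-- `v₃` vanishes at points with `|x₂| > b`, given the closing condition `iter h + μ = 0`.
[folklore] -/
theorem v3_eq_zero_of_abs_two {k : ℝ³ → ℝ} (hk : Continuous k) {μ : ℝ}
    (hclose : iter b (fun z => k z * g z) + μ = 0) {x : ℝ³} (hx : b < |x 2|) :
    v3 a b (fun z => k z * g z) μ x = 0 := by
  set F := fun z => k z * g z with hF
  have hFc : Continuous F := hk.mul d.continuous
  have hHc : Continuous (H a b F μ) :=
    (continuous_tot 0 _ _ hFc).add (continuous_const.mul (β_contDiff (a := a) (b := b)).continuous)
  have hJc : Continuous (tot 1 (-(2 * b)) (2 * b) (H a b F μ)) := continuous_tot 1 _ _ hHc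
  -- `J` vanishes along the `x₂`-line at heights `|t| > b`
  have hJline : ∀ t, b < |t| → tot 1 (-(2 * b)) (2 * b) (H a b F μ) (lineAt 2 x t) = 0 := by
    intro t ht
    refine tot_eq_zero_of_forall fun s _ => H_eq_zero_of_abs_two d.hb d.vanish k ?_
    rwa [lineAt_apply_ne (show (2 : Fin 3) ≠ 1 by decide), lineAt_apply_same]
  rw [v3]
  rcases lt_abs.1 hx with h | h
  · rw [prim_eq_tot_of_forall (b₀ := 2 * b) hJc, tot2_tot1_H d.ha d.hab hFc, hclose, mul_zero]
    intro t ht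
    refine hJline t ?_
    have : b < t := by
      rcases mem_uIoc.1 ht with ⟨h1, _⟩ | ⟨h1, _⟩
      · exact h.trans h1
      · linarith [d.hb]
    rwa [abs_of_pos (d.hb.trans this)]
  · have hx' : x 2 < -b := by linarith
    rw [prim_eq_zero_of_forall, mul_zero]
    intro t ht
    refine hJline t ?_
    have : t < -b := by
      rcases mem_uIoc.1 ht with ⟨_, h2⟩ | ⟨_, h2⟩
      · exact lt_of_le_of_lt h2 hx'
      · linarith [d.hb]
    rw [abs_of_neg (by linarith [d.hb])]; linarith

/-- Auxiliary (theorem `θ_factors_eq_zero`): θ factors eq zero. [folklore] -/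
theorem θ_factors_eq_zero {x : ℝ³} (hx : (∀ j, |x j| < a) ∨ b < |x 0|) :
    θp a b (x 0) = 0 ∧ θm a b (x 0) = 0 := by
  rcases hx with h | h
  · exact ⟨θp_eq_zero_of_abs_le d.hab (h 0).le, θm_eq_zero_of_abs_le d.hab (h 0).le⟩
  · exact ⟨θp_eq_zero_of_abs_ge d.ha d.hab h.le, θm_eq_zero_of_abs_ge d.ha d.hab h.le⟩

/-- **`c₁ = 0` off the shell.** [folklore] -/
theorem c₁_eq_zero {x : ℝ³} (hx : x ∉ shell a b) : c₁ a b g x = 0 := by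
  have hσc : Continuous (σ a) := (σ_contDiff (a := a)).continuous
  rw [c₁_eq]
  simp only
  rcases not_mem_shell.1 hx with h | ⟨j, hj⟩
  · obtain ⟨h1, h2⟩ := d.θ_factors_eq_zero (Or.inl h)
    rw [h1, h2]; ring
  · by_cases hj0 : j = 0
    · subst hj0
      obtain ⟨h1, h2⟩ := d.θ_factors_eq_zero (Or.inr hj)
      rw [h1, h2]; ring
    · have hσc' : Continuous fun z => 1 - σ a z := continuous_const.sub hσc
      rw [show gp a g = fun z => σ a z * g z from rfl, show gm a g = fun z => (1 - σ a z) * g z from rfl,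
        d.v2_eq_zero hσc _ hj0 hj, d.v2_eq_zero hσc' _ hj0 hj]
      ring

/-- **`c₂ = 0` off the shell.** [folklore] -/
theorem c₂_eq_zero {x : ℝ³} (hx : x ∉ shell a b) : c₂ a b g x = 0 := by
  have hσc : Continuous (σ a) := (σ_contDiff (a := a)).continuous
  rw [c₂_eq]
  simp only
  rcases not_mem_shell.1 hx with h | ⟨j, hj⟩
  · obtain ⟨h1, h2⟩ := d.θ_factors_eq_zero (Or.inl h)
    rw [h1, h2]; ring
  · rcases fin3_cases j with rfl | rfl | rfl
    · obtain ⟨h1, h2⟩ := d.θ_factors_eq_zero (Or.inr hj)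
      rw [h1, h2]; ring
    · rw [d.v3_eq_zero_of_abs_one _ _ hj, d.v3_eq_zero_of_abs_one _ _ hj]; ring
    · have hσc' : Continuous fun z => 1 - σ a z := continuous_const.sub hσc
      rw [show gp a g = fun z => σ a z * g z from rfl, show gm a g = fun z => (1 - σ a z) * g z from rfl,
        d.v3_eq_zero_of_abs_two hσc closing_gp hj, d.v3_eq_zero_of_abs_two hσc' d.closing_gm hj]
      ring

/-- **`W = 0` off the shell.** [folklore] -/
theorem W_eq_zero {x : ℝ³} (hx : x ∉ shell a b) : W a b g x = 0 := by
  rw [W, d.c₀_eq_zero hx, d.c₁_eq_zero hx, d.c₂_eq_zero hx]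
  simp

/-- Auxiliary (theorem `tsupport_W_subset`): tsupport W subset. [folklore] -/
theorem tsupport_W_subset : tsupport (W a b g) ⊆ shell a b :=
  closure_minimal (fun x hx => by by_contra h; exact hx (d.W_eq_zero h)) (isClosed_shell a b)

/-- Auxiliary (theorem `hasCompactSupport_W`): hasCompactSupport W. [folklore] -/
theorem hasCompactSupport_W : HasCompactSupport (W a b g) :=
  (isCompact_shell a b).of_isClosed_subset isClosed_closure d.tsupport_W_subset

end Datum

end Vanishing

/-! #### Bounds for the derivative of `W` -/

section DerivBounds

variable {a b G₀ G₁ : ℝ} {g : ℝ³ → ℝ}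

/-- `‖D(f - h)‖ ≤ ‖Df‖ + ‖Dh‖`. [folklore] -/
theorem norm_fderiv_sub_le {f h : ℝ³ → ℝ} {x : ℝ³} (hf : DifferentiableAt ℝ f x)
    (hh : DifferentiableAt ℝ h x) :
    ‖fderiv ℝ (fun y => f y - h y) x‖ ≤ ‖fderiv ℝ f x‖ + ‖fderiv ℝ h x‖ := by
  rw [fderiv_fun_sub hf hh]; exact norm_sub_le _ _

/-- `‖D(f + h)‖ ≤ ‖Df‖ + ‖Dh‖`. [folklore] -/
theorem norm_fderiv_add_le {f h : ℝ³ → ℝ} {x : ℝ³} (hf : DifferentiableAt ℝ f x)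
    (hh : DifferentiableAt ℝ h x) :
    ‖fderiv ℝ (fun y => f y + h y) x‖ ≤ ‖fderiv ℝ f x‖ + ‖fderiv ℝ h x‖ := by
  rw [fderiv_fun_add hf hh]; exact norm_add_le _ _

/-- Auxiliary (theorem `norm_fderiv_const_mul`): norm fderiv const mul. [folklore] -/
theorem norm_fderiv_const_mul {f : ℝ³ → ℝ} {x : ℝ³} (hf : DifferentiableAt ℝ f x) (c : ℝ) :
    ‖fderiv ℝ (fun y => c * f y) x‖ = |c| * ‖fderiv ℝ f x‖ := by
  rw [fderiv_const_mul hf, norm_smul, Real.norm_eq_abs]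

/-- The quantitative constant `Λ = B b/(b - a) ≥ 1`. [folklore] -/
def Λ (a b : ℝ) : ℝ := B * b / (b - a)

/-- The hypotheses for the bounds. [folklore] -/
structure BData (a b : ℝ) (g : ℝ³ → ℝ) (G₀ G₁ : ℝ) : Prop where
  /-- Field `ha`. -/
  ha : 0 < a
  /-- Field `hab`. -/
  hab : a < b
  /-- Field `hb2`. -/
  hb2 : b ≤ 2 * a
  /-- Field `smooth`. -/
  smooth : ContDiff ℝ ∞ g
  /-- Field `bound₀`. -/
  bound₀ : ∀ x, |g x| ≤ G₀
  /-- Field `bound₁`. -/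
  bound₁ : ∀ x, ‖fderiv ℝ g x‖ ≤ G₁

namespace BData

variable (d : BData a b g G₀ G₁)
include d

/-- Auxiliary (theorem `hb`): hb. [folklore] -/
theorem hb : 0 < b := d.ha.trans d.hab
/-- Auxiliary (theorem `hℓ`): hℓ. [folklore] -/
theorem hℓ : 0 < b - a := sub_pos.2 d.hab
/-- Auxiliary (theorem `G₀_nonneg`): G₀ nonneg. [folklore] -/
theorem G₀_nonneg : 0 ≤ G₀ := (abs_nonneg _).trans (d.bound₀ 0)
/-- Auxiliary (theorem `G₁_nonneg`): G₁ nonneg. [folklore] -/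
theorem G₁_nonneg : 0 ≤ G₁ := (norm_nonneg _).trans (d.bound₁ 0)
/-- Auxiliary (theorem `E_nonneg`): E nonneg. [folklore] -/
theorem E_nonneg : 0 ≤ G₀ + b * G₁ := add_nonneg d.G₀_nonneg (mul_nonneg d.hb.le d.G₁_nonneg)
/-- Auxiliary (theorem `G₀_le_E`): G₀ le E. [folklore] -/
theorem G₀_le_E : G₀ ≤ G₀ + b * G₁ := le_add_of_nonneg_right (mul_nonneg d.hb.le d.G₁_nonneg)
/-- Auxiliary (theorem `bG₁_le_E`): bG₁ le E. [folklore] -/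
theorem bG₁_le_E : b * G₁ ≤ G₀ + b * G₁ := le_add_of_nonneg_left d.G₀_nonneg

/-- Auxiliary (theorem `Λ_pos`): Λ pos. [folklore] -/
theorem Λ_pos : 0 < Λ a b := div_pos (mul_pos B_pos d.hb) d.hℓ

/-- Auxiliary (theorem `B_le_Λ`): B le Λ. [folklore] -/
theorem B_le_Λ : B ≤ Λ a b := by
  rw [Λ, le_div_iff₀ d.hℓ]; nlinarith [B_pos, d.ha]

/-- Auxiliary (theorem `one_le_Λ`): one le Λ. [folklore] -/
theorem one_le_Λ : 1 ≤ Λ a b := one_le_B.trans d.B_le_Λ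

/-- Auxiliary (theorem `Λ_le_Λ_pow`): Λ le Λ pow. [folklore] -/
theorem Λ_le_Λ_pow {m n : ℕ} (h : m ≤ n) : Λ a b ^ m ≤ Λ a b ^ n := pow_le_pow_right₀ d.one_le_Λ h

/-- Auxiliary (theorem `Λ_le_sq`): Λ le sq. [folklore] -/
theorem Λ_le_sq : Λ a b ≤ Λ a b ^ 2 := by simpa using d.Λ_le_Λ_pow (show 1 ≤ 2 by norm_num)

/-- `B/(b - a) = Λ/b`. [folklore] -/
theorem B_div_ℓ : B / (b - a) = Λ a b / b := by
  rw [Λ]; field_simp [d.hb.ne', d.hℓ.ne']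

/-- `B/(b-a)² ≤ Λ²/b²`. [folklore] -/
theorem B_div_ℓ_sq_le : B / (b - a) ^ 2 ≤ Λ a b ^ 2 / b ^ 2 := by
  have h1 : B / (b - a) ^ 2 = (Λ a b / b) ^ 2 / B := by
    rw [← d.B_div_ℓ]; field_simp [B_pos.ne', d.hℓ.ne']
  rw [h1, div_pow]
  exact div_le_self (by positivity) one_le_B

/-! ##### The one-variable factors -/

/-- Auxiliary (theorem `abs_θp_le`): abs θp le. [folklore] -/
theorem abs_θp_le (t : ℝ) : |θp a b t| ≤ 2 * Λ a b / b := by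
  refine (abs_bump_le (by linarith [d.hℓ]) t).trans (le_of_eq ?_)
  rw [show B / ((b - a) / 2) = 2 * (B / (b - a)) by field_simp, d.B_div_ℓ]; ring

/-- Auxiliary (theorem `abs_θm_le`): abs θm le. [folklore] -/
theorem abs_θm_le (t : ℝ) : |θm a b t| ≤ 2 * Λ a b / b := by
  refine (abs_bump_le (by linarith [d.hℓ]) t).trans (le_of_eq ?_)
  rw [show B / ((b - a) / 2) = 2 * (B / (b - a)) by field_simp, d.B_div_ℓ]; ring

/-- Auxiliary (theorem `abs_deriv_θp_le`): abs deriv θp le. [folklore] -/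
theorem abs_deriv_θp_le (t : ℝ) : |deriv (θp a b) t| ≤ 4 * Λ a b ^ 2 / b ^ 2 := by
  refine (abs_deriv_bump_le (by linarith [d.hℓ]) t).trans ?_
  rw [show B / ((b - a) / 2) ^ 2 = 4 * (B / (b - a) ^ 2) by field_simp; ring]
  have := d.B_div_ℓ_sq_le
  calc 4 * (B / (b - a) ^ 2) ≤ 4 * (Λ a b ^ 2 / b ^ 2) := by gcongr
    _ = 4 * Λ a b ^ 2 / b ^ 2 := by ring

/-- Auxiliary (theorem `abs_deriv_θm_le`): abs deriv θm le. [folklore] -/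
theorem abs_deriv_θm_le (t : ℝ) : |deriv (θm a b) t| ≤ 4 * Λ a b ^ 2 / b ^ 2 := by
  refine (abs_deriv_bump_le (by linarith [d.hℓ]) t).trans ?_
  rw [show B / ((b - a) / 2) ^ 2 = 4 * (B / (b - a) ^ 2) by field_simp; ring]
  have := d.B_div_ℓ_sq_le
  calc 4 * (B / (b - a) ^ 2) ≤ 4 * (Λ a b ^ 2 / b ^ 2) := by gcongr
    _ = 4 * Λ a b ^ 2 / b ^ 2 := by ring

/-- Auxiliary (theorem `abs_η_le`): abs η le. [folklore] -/
theorem abs_η_le (t : ℝ) : |η b t| ≤ Λ a b / b :=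
  (abs_bump_le d.hb t).trans (div_le_div_of_nonneg_right d.B_le_Λ d.hb.le)

/-- Auxiliary (theorem `abs_deriv_η_le`): abs deriv η le. [folklore] -/
theorem abs_deriv_η_le (t : ℝ) : |deriv (η b) t| ≤ Λ a b / b ^ 2 :=
  (abs_deriv_bump_le d.hb t).trans (div_le_div_of_nonneg_right d.B_le_Λ (by positivity))

/-- Auxiliary (theorem `abs_Θp_le`): abs Θp le. [folklore] -/
theorem abs_Θp_le (t : ℝ) : |Θp a b t| ≤ 1 := abs_step_le_one (by linarith [d.hℓ]) t
/-- Auxiliary (theorem `abs_Θm_le`): abs Θm le. [folklore] -/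
theorem abs_Θm_le (t : ℝ) : |Θm a b t| ≤ 1 := abs_step_le_one (by linarith [d.hℓ]) t
/-- Auxiliary (theorem `abs_Θ₂_le`): abs Θ₂ le. [folklore] -/
theorem abs_Θ₂_le (t : ℝ) : |Θ₂ b t| ≤ 1 := abs_step_le_one d.hb t

/-- Auxiliary (theorem `abs_σ_le`): abs σ le. [folklore] -/
theorem abs_σ_le (y : ℝ³) : |σ a y| ≤ 1 := abs_step_le_one d.ha _

/-- Auxiliary (theorem `abs_one_sub_σ_le`): abs one sub σ le. [folklore] -/
theorem abs_one_sub_σ_le (y : ℝ³) : |1 - σ a y| ≤ 1 := by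
  have h0 : 0 ≤ σ a y := step_nonneg (c := 0) d.ha (y 0)
  have h1 : σ a y ≤ 1 := step_le_one (c := 0) d.ha (y 0)
  rw [abs_le]
  constructor <;> linarith

/-- Auxiliary (theorem `norm_fderiv_σ_le`): norm fderiv σ le. [folklore] -/
theorem norm_fderiv_σ_le (y : ℝ³) : ‖fderiv ℝ (σ a) y‖ ≤ 2 * Λ a b / b := by
  refine (norm_fderiv_comp_coord_le (differentiable_step 0 a) 0 y).trans ?_
  rw [deriv_step]
  refine (abs_bump_le d.ha _).trans ?_
  rw [div_le_div_iff₀ d.ha d.hb]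
  nlinarith [d.B_le_Λ, d.hb2, B_pos, d.hb]

/-- Auxiliary (theorem `norm_fderiv_one_sub_σ_le`): norm fderiv one sub σ le. [folklore] -/
theorem norm_fderiv_one_sub_σ_le (y : ℝ³) : ‖fderiv ℝ (fun z => 1 - σ a z) y‖ ≤ 2 * Λ a b / b := by
  rw [fderiv_fun_sub (differentiableAt_const _) (dAt σ_contDiff y), fderiv_fun_const, Pi.zero_apply, zero_sub,
    norm_neg]
  exact d.norm_fderiv_σ_le y

/-! ##### The pieces `g±` and their line integrals -/

/-- Bounds for a piece `k g` with `|k| ≤ 1`, `‖Dk‖ ≤ 2Λ/b`. [folklore] -/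
theorem piece_bounds {k : ℝ³ → ℝ} (hk : ContDiff ℝ ∞ k) (hk₀ : ∀ y, |k y| ≤ 1)
    (hk₁ : ∀ y, ‖fderiv ℝ k y‖ ≤ 2 * Λ a b / b) (y : ℝ³) :
    |k y * g y| ≤ G₀ ∧ ‖fderiv ℝ (fun z => k z * g z) y‖ ≤ 2 * Λ a b * (G₀ + b * G₁) / b := by
  refine ⟨?_, ?_⟩
  · rw [abs_mul]
    calc |k y| * |g y| ≤ 1 * G₀ := mul_le_mul (hk₀ y) (d.bound₀ y) (abs_nonneg _) zero_le_one
      _ = G₀ := one_mul _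
  · refine (norm_fderiv_mul_le (dAt hk y) (dAt d.smooth y)).trans ?_
    have h1 : |k y| * ‖fderiv ℝ g y‖ ≤ 1 * G₁ :=
      mul_le_mul (hk₀ y) (d.bound₁ y) (norm_nonneg _) zero_le_one
    have h2 : |g y| * ‖fderiv ℝ k y‖ ≤ G₀ * (2 * Λ a b / b) :=
      mul_le_mul (d.bound₀ y) (hk₁ y) (norm_nonneg _) d.G₀_nonneg
    have hΛ := d.one_le_Λ
    have hb := d.hb
    rw [div_eq_mul_inv] at h2 ⊢
    have : G₁ ≤ 2 * Λ a b * G₁ := by nlinarith [d.G₁_nonneg]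
    nlinarith [mul_inv_cancel₀ hb.ne', d.G₀_nonneg, d.G₁_nonneg, inv_pos.2 hb]

/-- Auxiliary (theorem `gp_bounds`): gp bounds. [folklore] -/
theorem gp_bounds (y : ℝ³) :
    |gp a g y| ≤ G₀ ∧ ‖fderiv ℝ (gp a g) y‖ ≤ 2 * Λ a b * (G₀ + b * G₁) / b :=
  d.piece_bounds σ_contDiff d.abs_σ_le d.norm_fderiv_σ_le y

/-- Auxiliary (theorem `gm_bounds`): gm bounds. [folklore] -/
theorem gm_bounds (y : ℝ³) :
    |gm a g y| ≤ G₀ ∧ ‖fderiv ℝ (gm a g) y‖ ≤ 2 * Λ a b * (G₀ + b * G₁) / b :=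
  d.piece_bounds (contDiff_const.sub σ_contDiff) d.abs_one_sub_σ_le d.norm_fderiv_one_sub_σ_le y

/-! ##### Line integrals of the pieces, the mass, `β`, `H`, `J` -/

/-- Auxiliary (theorem `abs_four_b`): abs four b. [folklore] -/
theorem abs_four_b : |2 * b - -(2 * b)| = 4 * b := by
  rw [show 2 * b - -(2 * b) = 4 * b by ring, abs_of_pos (by linarith [d.hb])]

/-- Bounds for `G = ∫ k g dx₀` of a piece. [folklore] -/
theorem G_bounds {k : ℝ³ → ℝ} (hk : ContDiff ℝ ∞ k) (hk₀ : ∀ y, |k y| ≤ 1)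
    (hk₁ : ∀ y, ‖fderiv ℝ k y‖ ≤ 2 * Λ a b / b) (y : ℝ³) :
    |tot 0 (-(2 * b)) (2 * b) (fun z => k z * g z) y| ≤ 4 * b * G₀ ∧
    ‖fderiv ℝ (tot 0 (-(2 * b)) (2 * b) (fun z => k z * g z)) y‖ ≤ 24 * Λ a b * (G₀ + b * G₁) := by
  have hp := fun z => d.piece_bounds hk hk₀ hk₁ z
  refine ⟨?_, ?_⟩
  · have := abs_tot_le (i := 0) (a₀ := -(2 * b)) (b₀ := 2 * b) (fun z => (hp z).1) y
    rwa [d.abs_four_b] at this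
  · have h := norm_fderiv_tot_le (i := 0) (a₀ := -(2 * b)) (b₀ := 2 * b) (hk.mul d.smooth)
      (G₁ := 2 * Λ a b * (G₀ + b * G₁) / b)
      (by have := d.Λ_pos; have := d.E_nonneg; have := d.hb; positivity) (fun z => (hp z).2) y
    rw [d.abs_four_b] at h
    refine h.trans (le_of_eq ?_)
    field_simp [d.hb.ne']
    ring

/-- Auxiliary (theorem `Gp_bounds`): Gp bounds. [folklore] -/
theorem Gp_bounds (y : ℝ³) :
    |tot 0 (-(2 * b)) (2 * b) (gp a g) y| ≤ 4 * b * G₀ ∧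
    ‖fderiv ℝ (tot 0 (-(2 * b)) (2 * b) (gp a g)) y‖ ≤ 24 * Λ a b * (G₀ + b * G₁) :=
  d.G_bounds σ_contDiff d.abs_σ_le d.norm_fderiv_σ_le y

/-- Auxiliary (theorem `Gm_bounds`): Gm bounds. [folklore] -/
theorem Gm_bounds (y : ℝ³) :
    |tot 0 (-(2 * b)) (2 * b) (gm a g) y| ≤ 4 * b * G₀ ∧
    ‖fderiv ℝ (tot 0 (-(2 * b)) (2 * b) (gm a g)) y‖ ≤ 24 * Λ a b * (G₀ + b * G₁) :=
  d.G_bounds (contDiff_const.sub σ_contDiff) d.abs_one_sub_σ_le d.norm_fderiv_one_sub_σ_le y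

/-- `|m| ≤ 64 b³ G₀`. [folklore] -/
theorem abs_mass_le : |mass a b g| ≤ 64 * b ^ 3 * G₀ := by
  rw [mass, iter]
  have h0 : ∀ y, |tot 0 (-(2 * b)) (2 * b) (gp a g) y| ≤ 4 * b * G₀ := fun y => (d.Gp_bounds y).1
  have h1 : ∀ y, |tot 1 (-(2 * b)) (2 * b) (tot 0 (-(2 * b)) (2 * b) (gp a g)) y| ≤
      4 * b * (4 * b * G₀) := fun y => by
    have := abs_tot_le (i := 1) (a₀ := -(2 * b)) (b₀ := 2 * b) h0 y
    rwa [d.abs_four_b] at this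
  have := abs_tot_le (i := 2) (a₀ := -(2 * b)) (b₀ := 2 * b) h1 0
  rw [d.abs_four_b] at this
  refine this.trans (le_of_eq ?_); ring

/-- Auxiliary (theorem `abs_β_le`): abs β le. [folklore] -/
theorem abs_β_le (y : ℝ³) : |β a b y| ≤ 2 * Λ a b ^ 2 / b ^ 2 := by
  rw [β, abs_mul]
  have hL := d.Λ_pos
  have hb := d.hb
  calc |θp a b (y 1)| * |η b (y 2)| ≤ (2 * Λ a b / b) * (Λ a b / b) :=
        mul_le_mul (d.abs_θp_le _) (d.abs_η_le _) (abs_nonneg _) (by positivity)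
    _ = 2 * Λ a b ^ 2 / b ^ 2 := by field_simp

/-- Auxiliary (theorem `norm_fderiv_β_le`): norm fderiv β le. [folklore] -/
theorem norm_fderiv_β_le (y : ℝ³) : ‖fderiv ℝ (β a b) y‖ ≤ 6 * Λ a b ^ 3 / b ^ 3 := by
  have hL := d.Λ_pos
  have hL1 := d.one_le_Λ
  have hb := d.hb
  have h := norm_fderiv_mul_le (f := fun z : ℝ³ => θp a b (z 1)) (h := fun z : ℝ³ => η b (z 2))
    (dAt (contDiff_comp_coord (θp_contDiff a b) 1) y) (dAt (contDiff_comp_coord (η_contDiff b) 2) y)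
  rw [show (fun z : ℝ³ => θp a b (z 1) * η b (z 2)) = β a b from rfl] at h
  refine h.trans ?_
  have h1 : |θp a b (y 1)| * ‖fderiv ℝ (fun z : ℝ³ => η b (z 2)) y‖ ≤
      (2 * Λ a b / b) * (Λ a b / b ^ 2) :=
    mul_le_mul (d.abs_θp_le _) ((norm_fderiv_comp_coord_le (bump_contDiff 0 b (n := 1)
      |>.differentiable (by simp)) 2 y).trans (d.abs_deriv_η_le _)) (norm_nonneg _) (by positivity)
  have h2 : |η b (y 2)| * ‖fderiv ℝ (fun z : ℝ³ => θp a b (z 1)) y‖ ≤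
      (Λ a b / b) * (4 * Λ a b ^ 2 / b ^ 2) :=
    mul_le_mul (d.abs_η_le _) ((norm_fderiv_comp_coord_le (bump_contDiff _ _ (n := 1)
      |>.differentiable (by simp)) 1 y).trans (d.abs_deriv_θp_le _)) (norm_nonneg _) (by positivity)
  calc _ ≤ (2 * Λ a b / b) * (Λ a b / b ^ 2) + (Λ a b / b) * (4 * Λ a b ^ 2 / b ^ 2) := add_le_add h1 h2
    _ = (2 * Λ a b ^ 2 + 4 * Λ a b ^ 3) / b ^ 3 := by field_simp
    _ ≤ 6 * Λ a b ^ 3 / b ^ 3 := by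
        refine div_le_div_of_nonneg_right ?_ (by positivity)
        nlinarith [d.Λ_le_Λ_pow (show 2 ≤ 3 by norm_num)]

/-- Bounds for `H = G + μβ`, `|μ| ≤ 64 b³ G₀`. [folklore] -/
theorem H_bounds {k : ℝ³ → ℝ} (hk : ContDiff ℝ ∞ k) (hk₀ : ∀ y, |k y| ≤ 1)
    (hk₁ : ∀ y, ‖fderiv ℝ k y‖ ≤ 2 * Λ a b / b) {μ : ℝ} (hμ : |μ| ≤ 64 * b ^ 3 * G₀) (y : ℝ³) :
    |H a b (fun z => k z * g z) μ y| ≤ 132 * Λ a b ^ 2 * b * (G₀ + b * G₁) ∧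
    ‖fderiv ℝ (H a b (fun z => k z * g z) μ) y‖ ≤ 408 * Λ a b ^ 3 * (G₀ + b * G₁) := by
  have hL := d.Λ_pos
  have hL1 := d.one_le_Λ
  have hb := d.hb
  have hE := d.E_nonneg
  have hG₀ := d.G₀_nonneg
  have hGE := d.G₀_le_E
  obtain ⟨hG0, hG1⟩ := d.G_bounds hk hk₀ hk₁ y
  have hL2 : Λ a b ≤ Λ a b ^ 2 := d.Λ_le_sq
  have hL3 : Λ a b ≤ Λ a b ^ 3 := by simpa using d.Λ_le_Λ_pow (show 1 ≤ 3 by norm_num)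
  refine ⟨?_, ?_⟩
  · rw [H]
    refine (abs_add_le _ _).trans ?_
    rw [abs_mul]
    have h2 : |μ| * |β a b y| ≤ (64 * b ^ 3 * G₀) * (2 * Λ a b ^ 2 / b ^ 2) :=
      mul_le_mul hμ (d.abs_β_le y) (abs_nonneg _) (by positivity)
    have h3 : (64 * b ^ 3 * G₀) * (2 * Λ a b ^ 2 / b ^ 2) = 128 * Λ a b ^ 2 * b * G₀ := by
      field_simp; ring
    rw [h3] at h2
    have h1sq : 1 ≤ Λ a b ^ 2 := by nlinarith
    have h4 : b * G₀ ≤ Λ a b ^ 2 * b * (G₀ + b * G₁) := by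
      have h5 : b * G₀ ≤ b * (G₀ + b * G₁) := mul_le_mul_of_nonneg_left hGE hb.le
      have h6 : b * (G₀ + b * G₁) ≤ Λ a b ^ 2 * (b * (G₀ + b * G₁)) :=
        le_mul_of_one_le_left (mul_nonneg hb.le hE) h1sq
      linarith
    have h7 : Λ a b ^ 2 * b * G₀ ≤ Λ a b ^ 2 * b * (G₀ + b * G₁) :=
      mul_le_mul_of_nonneg_left hGE (by positivity)
    linarith
  · have hd1 : DifferentiableAt ℝ (tot 0 (-(2 * b)) (2 * b) (fun z => k z * g z)) y :=
      dAt (contDiff_tot 0 _ _ (hk.mul d.smooth)) y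
    have hd2 : DifferentiableAt ℝ (fun z => μ * β a b z) y := dAt (contDiff_const.mul β_contDiff) y
    have h := norm_fderiv_add_le hd1 hd2
    rw [show (fun z => tot 0 (-(2 * b)) (2 * b) (fun z => k z * g z) z + μ * β a b z) =
      H a b (fun z => k z * g z) μ from rfl] at h
    refine h.trans ?_
    rw [norm_fderiv_const_mul (dAt β_contDiff y)]
    have h2 : |μ| * ‖fderiv ℝ (β a b) y‖ ≤ (64 * b ^ 3 * G₀) * (6 * Λ a b ^ 3 / b ^ 3) :=
      mul_le_mul hμ (d.norm_fderiv_β_le y) (norm_nonneg _) (by positivity)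
    have h3 : (64 * b ^ 3 * G₀) * (6 * Λ a b ^ 3 / b ^ 3) = 384 * Λ a b ^ 3 * G₀ := by
      field_simp; ring
    rw [h3] at h2
    nlinarith [mul_nonneg (pow_nonneg hL.le 3) hE]

/-- Auxiliary (theorem `Hp_bounds`): Hp bounds. [folklore] -/
theorem Hp_bounds (y : ℝ³) :
    |H a b (gp a g) (-mass a b g) y| ≤ 132 * Λ a b ^ 2 * b * (G₀ + b * G₁) ∧
    ‖fderiv ℝ (H a b (gp a g) (-mass a b g)) y‖ ≤ 408 * Λ a b ^ 3 * (G₀ + b * G₁) :=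
  d.H_bounds σ_contDiff d.abs_σ_le d.norm_fderiv_σ_le (by rw [abs_neg]; exact d.abs_mass_le) y

/-- Auxiliary (theorem `Hm_bounds`): Hm bounds. [folklore] -/
theorem Hm_bounds (y : ℝ³) :
    |H a b (gm a g) (mass a b g) y| ≤ 132 * Λ a b ^ 2 * b * (G₀ + b * G₁) ∧
    ‖fderiv ℝ (H a b (gm a g) (mass a b g)) y‖ ≤ 408 * Λ a b ^ 3 * (G₀ + b * G₁) :=
  d.H_bounds (contDiff_const.sub σ_contDiff) d.abs_one_sub_σ_le d.norm_fderiv_one_sub_σ_le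
    d.abs_mass_le y

/-- Bounds for `J = ∫ H dx₁`. [folklore] -/
theorem J_bounds {h : ℝ³ → ℝ} {μ : ℝ} (hh : ContDiff ℝ ∞ h)
    (hH : ∀ y, |H a b h μ y| ≤ 132 * Λ a b ^ 2 * b * (G₀ + b * G₁) ∧
      ‖fderiv ℝ (H a b h μ) y‖ ≤ 408 * Λ a b ^ 3 * (G₀ + b * G₁)) (y : ℝ³) :
    |tot 1 (-(2 * b)) (2 * b) (H a b h μ) y| ≤ 528 * Λ a b ^ 2 * b ^ 2 * (G₀ + b * G₁) ∧
    ‖fderiv ℝ (tot 1 (-(2 * b)) (2 * b) (H a b h μ)) y‖ ≤ 4896 * Λ a b ^ 3 * b * (G₀ + b * G₁) := by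
  have hL := d.Λ_pos
  have hE := d.E_nonneg
  have hb := d.hb
  refine ⟨?_, ?_⟩
  · have := abs_tot_le (i := 1) (a₀ := -(2 * b)) (b₀ := 2 * b) (fun z => (hH z).1) y
    rw [d.abs_four_b] at this
    refine this.trans (le_of_eq ?_); ring
  · have := norm_fderiv_tot_le (i := 1) (a₀ := -(2 * b)) (b₀ := 2 * b) (H_contDiff hh μ)
      (by positivity) (fun z => (hH z).2) y
    rw [d.abs_four_b] at this
    refine this.trans (le_of_eq ?_); ring

/-! ##### Pointwise bounds in the cube -/

omit d in
/-- Auxiliary (theorem `abs_coord_add_le`): abs coord add le. [folklore] -/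
theorem abs_coord_add_le {x : ℝ³} (hx : x ∈ cube b) (i : Fin 3) : |x i - -(2 * b)| ≤ 3 * b := by
  have h := hx i
  rw [abs_le] at h ⊢
  constructor <;> linarith

omit d in
/-- Derivative bound for a stage at a point of the cube, from bounds on its input. [folklore] -/
theorem norm_fderiv_stage_le {i : Fin 3} {F : ℝ³ → ℝ} {Θ : ℝ → ℝ} (hF : ContDiff ℝ ∞ F)
    (hΘ : ContDiff ℝ ∞ Θ) {F₀ F₁ T₀ T₁ θ₀ : ℝ} (hF₀ : ∀ y, |F y| ≤ F₀) (hF₁n : 0 ≤ F₁)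
    (hF₁ : ∀ y, ‖fderiv ℝ F y‖ ≤ F₁) (hT₀ : ∀ y, |tot i (-(2 * b)) (2 * b) F y| ≤ T₀)
    (hT₁ : ∀ y, ‖fderiv ℝ (tot i (-(2 * b)) (2 * b) F) y‖ ≤ T₁) (hΘ₀ : ∀ t, |Θ t| ≤ 1)
    (hθ₀ : ∀ t, |deriv Θ t| ≤ θ₀) {x : ℝ³} (hx : x ∈ cube b) :
    ‖fderiv ℝ (stage i b F Θ) x‖ ≤ F₀ + 6 * b * F₁ + T₁ + T₀ * θ₀ := by
  have hT₀n : 0 ≤ T₀ := (abs_nonneg _).trans (hT₀ 0)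
  have h1 := norm_fderiv_prim_le (i := i) (a₀ := -(2 * b)) hF hF₀ hF₁n hF₁ x
  have h2 := norm_fderiv_mul_le (f := fun y : ℝ³ => Θ (y i)) (h := tot i (-(2 * b)) (2 * b) F)
    (dAt (contDiff_comp_coord hΘ i) x) (dAt (contDiff_tot i _ _ hF) x)
  have h3 := norm_fderiv_sub_le (dAt (contDiff_prim i (-(2 * b)) hF) x)
    (dAt ((contDiff_comp_coord hΘ i).mul (contDiff_tot i (-(2 * b)) (2 * b) hF)) x)
  change ‖fderiv ℝ (fun y => prim i (-(2 * b)) F y - Θ (y i) * tot i (-(2 * b)) (2 * b) F y) x‖ ≤ _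
  refine h3.trans ?_
  have h4 : |Θ (x i)| * ‖fderiv ℝ (tot i (-(2 * b)) (2 * b) F) x‖ ≤ 1 * T₁ :=
    mul_le_mul (hΘ₀ _) (hT₁ x) (norm_nonneg _) zero_le_one
  have h5 : |tot i (-(2 * b)) (2 * b) F x| * ‖fderiv ℝ (fun y : ℝ³ => Θ (y i)) x‖ ≤ T₀ * θ₀ :=
    mul_le_mul (hT₀ x) ((norm_fderiv_comp_coord_le (hΘ.differentiable (by simp)) i x).trans (hθ₀ _))
      (norm_nonneg _) hT₀n
  have h6 : |x i - -(2 * b)| * F₁ ≤ 3 * b * F₁ :=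
    mul_le_mul_of_nonneg_right (abs_coord_add_le hx i) hF₁n
  linarith

omit d in
/-- Value bound for a stage at a point of the cube. [folklore] -/
theorem abs_stage_le {i : Fin 3} {F : ℝ³ → ℝ} {Θ : ℝ → ℝ} {F₀ T₀ : ℝ} (hF₀ : ∀ y, |F y| ≤ F₀)
    (hT₀ : ∀ y, |tot i (-(2 * b)) (2 * b) F y| ≤ T₀) (hΘ₀ : ∀ t, |Θ t| ≤ 1) {x : ℝ³}
    (hx : x ∈ cube b) : |stage i b F Θ x| ≤ 3 * b * F₀ + T₀ := by
  have hF₀n : 0 ≤ F₀ := (abs_nonneg _).trans (hF₀ 0)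
  have hT₀n : 0 ≤ T₀ := (abs_nonneg _).trans (hT₀ 0)
  rw [stage]
  refine (abs_sub _ _).trans ?_
  have h1 := abs_prim_le (i := i) (a₀ := -(2 * b)) hF₀ x
  have h2 : |Θ (x i) * tot i (-(2 * b)) (2 * b) F x| ≤ 1 * T₀ := by
    rw [abs_mul]; exact mul_le_mul (hΘ₀ _) (hT₀ x) (abs_nonneg _) zero_le_one
  have h3 : |x i - -(2 * b)| * F₀ ≤ 3 * b * F₀ :=
    mul_le_mul_of_nonneg_right (abs_coord_add_le hx i) hF₀n
  linarith

/-- **`‖D(stage 0)‖ ≤ 45 Λ E`** in the cube, for both pieces. [folklore] -/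
theorem norm_fderiv_stage0_le {k : ℝ³ → ℝ} (hk : ContDiff ℝ ∞ k) (hk₀ : ∀ y, |k y| ≤ 1)
    (hk₁ : ∀ y, ‖fderiv ℝ k y‖ ≤ 2 * Λ a b / b) {Θ : ℝ → ℝ} (hΘ : ContDiff ℝ ∞ Θ)
    (hΘ₀ : ∀ t, |Θ t| ≤ 1) (hθ₀ : ∀ t, |deriv Θ t| ≤ 2 * Λ a b / b) {x : ℝ³} (hx : x ∈ cube b) :
    ‖fderiv ℝ (stage 0 b (fun z => k z * g z) Θ) x‖ ≤ 45 * Λ a b * (G₀ + b * G₁) := by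
  have hL := d.Λ_pos; have hb := d.hb; have hE := d.E_nonneg; have hL1 := d.one_le_Λ
  have hp := fun y => d.piece_bounds hk hk₀ hk₁ y
  have hG := fun y => d.G_bounds hk hk₀ hk₁ y
  have h := norm_fderiv_stage_le (b := b) (i := 0) (hk.mul d.smooth) hΘ (fun y => (hp y).1) (by positivity)
    (fun y => (hp y).2) (fun y => (hG y).1) (fun y => (hG y).2) hΘ₀ hθ₀ hx
  refine h.trans ?_
  have e1 : 6 * b * (2 * Λ a b * (G₀ + b * G₁) / b) = 12 * Λ a b * (G₀ + b * G₁) := by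
    field_simp; ring
  have e2 : 4 * b * G₀ * (2 * Λ a b / b) = 8 * Λ a b * G₀ := by field_simp; ring
  rw [e1, e2]
  nlinarith [d.G₀_le_E, d.G₀_nonneg]

/-- **`‖D(transfer)‖ ≤ 1280 Λ³ E`.** [folklore] -/
theorem norm_fderiv_transfer_le (x : ℝ³) :
    ‖fderiv ℝ (transfer a b g) x‖ ≤ 1280 * Λ a b ^ 3 * (G₀ + b * G₁) := by
  have hL := d.Λ_pos; have hb := d.hb; have hE := d.E_nonneg; have hL1 := d.one_le_Λ
  have hG₀ := d.G₀_nonneg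
  have hΘ : ContDiff ℝ ∞ (fun s => Θp a b s - Θm a b s) := (Θp_contDiff a b).sub (Θm_contDiff a b)
  have hd1 : DifferentiableAt ℝ (fun y => mass a b g * β a b y) x := dAt (contDiff_const.mul β_contDiff) x
  have hd2 : DifferentiableAt ℝ (fun y : ℝ³ => Θp a b (y 0) - Θm a b (y 0)) x :=
    dAt (contDiff_comp_coord hΘ 0) x
  have h := norm_fderiv_mul_le hd1 hd2
  rw [show (fun y => mass a b g * β a b y * (Θp a b (y 0) - Θm a b (y 0))) = transfer a b g from rfl] at h
  refine h.trans ?_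
  -- the four factors
  have f1 : |mass a b g * β a b x| ≤ (64 * b ^ 3 * G₀) * (2 * Λ a b ^ 2 / b ^ 2) := by
    rw [abs_mul]; exact mul_le_mul d.abs_mass_le (d.abs_β_le x) (abs_nonneg _) (by positivity)
  have f2 : ‖fderiv ℝ (fun y : ℝ³ => Θp a b (y 0) - Θm a b (y 0)) x‖ ≤ 4 * Λ a b / b := by
    refine (norm_fderiv_comp_coord_le (θ := fun s => Θp a b s - Θm a b s)
      (hΘ.differentiable (by simp)) 0 x).trans ?_
    have d1 : DifferentiableAt ℝ (Θp a b) (x 0) := differentiable_step _ _ _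
    have d2 : DifferentiableAt ℝ (Θm a b) (x 0) := differentiable_step _ _ _
    rw [deriv_fun_sub d1 d2, deriv_Θp, deriv_Θm]
    calc |θp a b (x 0) - θm a b (x 0)| ≤ |θp a b (x 0)| + |θm a b (x 0)| := abs_sub _ _
      _ ≤ 2 * Λ a b / b + 2 * Λ a b / b := add_le_add (d.abs_θp_le _) (d.abs_θm_le _)
      _ = 4 * Λ a b / b := by ring
  have f3 : |Θp a b (x 0) - Θm a b (x 0)| ≤ 2 := by
    refine (abs_sub _ _).trans ?_
    have := d.abs_Θp_le (x 0); have := d.abs_Θm_le (x 0)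
    linarith
  have f4 : ‖fderiv ℝ (fun y => mass a b g * β a b y) x‖ ≤ (64 * b ^ 3 * G₀) * (6 * Λ a b ^ 3 / b ^ 3) := by
    rw [norm_fderiv_const_mul (dAt β_contDiff x)]
    exact mul_le_mul d.abs_mass_le (d.norm_fderiv_β_le x) (norm_nonneg _) (by positivity)
  have p1 : |mass a b g * β a b x| * ‖fderiv ℝ (fun y : ℝ³ => Θp a b (y 0) - Θm a b (y 0)) x‖ ≤
      (64 * b ^ 3 * G₀) * (2 * Λ a b ^ 2 / b ^ 2) * (4 * Λ a b / b) :=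
    mul_le_mul f1 f2 (norm_nonneg _) (by positivity)
  have p2 : |Θp a b (x 0) - Θm a b (x 0)| * ‖fderiv ℝ (fun y => mass a b g * β a b y) x‖ ≤
      2 * ((64 * b ^ 3 * G₀) * (6 * Λ a b ^ 3 / b ^ 3)) :=
    mul_le_mul f3 f4 (norm_nonneg _) (by norm_num)
  have e1 : (64 * b ^ 3 * G₀) * (2 * Λ a b ^ 2 / b ^ 2) * (4 * Λ a b / b) = 512 * Λ a b ^ 3 * G₀ := by
    field_simp; ring
  have e2 : 2 * ((64 * b ^ 3 * G₀) * (6 * Λ a b ^ 3 / b ^ 3)) = 768 * Λ a b ^ 3 * G₀ := by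
    field_simp; ring
  rw [e1] at p1; rw [e2] at p2
  nlinarith [d.G₀_le_E, pow_nonneg hL.le 3]

/-- **`‖Dc₀‖ ≤ 1370 Λ³ E`** in the cube. [folklore] -/
theorem norm_fderiv_c₀_le {x : ℝ³} (hx : x ∈ cube b) :
    ‖fderiv ℝ (c₀ a b g) x‖ ≤ 1370 * Λ a b ^ 3 * (G₀ + b * G₁) := by
  have hL := d.Λ_pos; have hE := d.E_nonneg; have hL1 := d.one_le_Λ
  have hL3 : Λ a b ≤ Λ a b ^ 3 := by simpa using d.Λ_le_Λ_pow (show 1 ≤ 3 by norm_num)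
  have hs1 := d.norm_fderiv_stage0_le σ_contDiff d.abs_σ_le d.norm_fderiv_σ_le (Θp_contDiff a b)
    d.abs_Θp_le (fun t => by rw [deriv_Θp]; exact d.abs_θp_le t) hx
  have hs2 := d.norm_fderiv_stage0_le (contDiff_const.sub σ_contDiff) d.abs_one_sub_σ_le
    d.norm_fderiv_one_sub_σ_le (Θm_contDiff a b) d.abs_Θm_le
    (fun t => by rw [deriv_Θm]; exact d.abs_θm_le t) hx
  have ht := d.norm_fderiv_transfer_le x
  have d1 : DifferentiableAt ℝ (stage 0 b (gp a g) (Θp a b)) x :=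
    dAt (stage_contDiff (gp_contDiff d.smooth) (Θp_contDiff a b)) x
  have d2 : DifferentiableAt ℝ (stage 0 b (gm a g) (Θm a b)) x :=
    dAt (stage_contDiff (gm_contDiff d.smooth) (Θm_contDiff a b)) x
  have d3 : DifferentiableAt ℝ (transfer a b g) x := dAt transfer_contDiff x
  have hc : HasFDerivAt (c₀ a b g) (fderiv ℝ (stage 0 b (gp a g) (Θp a b)) x +
      fderiv ℝ (stage 0 b (gm a g) (Θm a b)) x + fderiv ℝ (transfer a b g) x) x := by
    rw [c₀_eq]; exact (d1.hasFDerivAt.add d2.hasFDerivAt).add d3.hasFDerivAt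
  rw [hc.fderiv]
  have hs1' : ‖fderiv ℝ (stage 0 b (gp a g) (Θp a b)) x‖ ≤ 45 * Λ a b * (G₀ + b * G₁) := hs1
  have hs2' : ‖fderiv ℝ (stage 0 b (gm a g) (Θm a b)) x‖ ≤ 45 * Λ a b * (G₀ + b * G₁) := hs2
  have hmono : Λ a b * (G₀ + b * G₁) ≤ Λ a b ^ 3 * (G₀ + b * G₁) :=
    mul_le_mul_of_nonneg_right hL3 hE
  calc _ ≤ ‖fderiv ℝ (stage 0 b (gp a g) (Θp a b)) x + fderiv ℝ (stage 0 b (gm a g) (Θm a b)) x‖ +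
        ‖fderiv ℝ (transfer a b g) x‖ := norm_add_le _ _
    _ ≤ ‖fderiv ℝ (stage 0 b (gp a g) (Θp a b)) x‖ + ‖fderiv ℝ (stage 0 b (gm a g) (Θm a b)) x‖ +
        ‖fderiv ℝ (transfer a b g) x‖ := by gcongr; exact norm_add_le _ _
    _ ≤ _ := by linarith

/-- **`‖Dv₂‖ ≤ 8004 Λ³ b E`** and **`|v₂| ≤ 924 Λ² b² E`** in the cube. [folklore] -/
theorem v2_bounds {h : ℝ³ → ℝ} {μ : ℝ} (hh : ContDiff ℝ ∞ h)
    (hH : ∀ y, |H a b h μ y| ≤ 132 * Λ a b ^ 2 * b * (G₀ + b * G₁) ∧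
      ‖fderiv ℝ (H a b h μ) y‖ ≤ 408 * Λ a b ^ 3 * (G₀ + b * G₁)) {x : ℝ³} (hx : x ∈ cube b) :
    |v2 a b h μ x| ≤ 924 * Λ a b ^ 2 * b ^ 2 * (G₀ + b * G₁) ∧
    ‖fderiv ℝ (v2 a b h μ) x‖ ≤ 8004 * Λ a b ^ 3 * b * (G₀ + b * G₁) := by
  have hL := d.Λ_pos; have hb := d.hb; have hE := d.E_nonneg; have hL1 := d.one_le_Λ
  have hJ := fun y => d.J_bounds hh hH y
  have hHc := H_contDiff (a := a) (b := b) hh μ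
  refine ⟨?_, ?_⟩
  · have h := abs_stage_le (b := b) (i := 1) (Θ := Θ₂ b) (fun y => (hH y).1) (fun y => (hJ y).1)
      d.abs_Θ₂_le hx
    refine h.trans (le_of_eq ?_); ring
  · have h := norm_fderiv_stage_le (b := b) (i := 1) hHc (Θ₂_contDiff b) (fun y => (hH y).1)
      (by positivity) (fun y => (hH y).2) (fun y => (hJ y).1) (fun y => (hJ y).2) d.abs_Θ₂_le
      (fun t => by rw [deriv_Θ₂]; exact d.abs_η_le t) hx
    refine h.trans ?_
    have e1 : 528 * Λ a b ^ 2 * b ^ 2 * (G₀ + b * G₁) * (Λ a b / b) =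
        528 * Λ a b ^ 3 * b * (G₀ + b * G₁) := by field_simp
    rw [e1]
    have hm : Λ a b ^ 2 * b * (G₀ + b * G₁) ≤ Λ a b ^ 3 * b * (G₀ + b * G₁) := by
      have := d.Λ_le_Λ_pow (show 2 ≤ 3 by norm_num)
      have hbE : 0 ≤ b * (G₀ + b * G₁) := mul_nonneg hb.le hE
      nlinarith
    nlinarith

/-- Derivative bound for `θ(x₀) v(x)` from bounds on `v`. [folklore] -/
theorem norm_fderiv_θ_mul_le {θ : ℝ → ℝ} (hθ : ContDiff ℝ ∞ θ) (hθ₀ : ∀ t, |θ t| ≤ 2 * Λ a b / b)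
    (hθ₁ : ∀ t, |deriv θ t| ≤ 4 * Λ a b ^ 2 / b ^ 2) {v : ℝ³ → ℝ} (hv : ContDiff ℝ ∞ v) {x : ℝ³}
    {V₀ V₁ : ℝ} (hV₀ : |v x| ≤ V₀) (hV₁ : ‖fderiv ℝ v x‖ ≤ V₁) :
    ‖fderiv ℝ (fun y => θ (y 0) * v y) x‖ ≤ 2 * Λ a b / b * V₁ + V₀ * (4 * Λ a b ^ 2 / b ^ 2) := by
  have hV₀n : 0 ≤ V₀ := (abs_nonneg _).trans hV₀
  have h := norm_fderiv_mul_le (f := fun y : ℝ³ => θ (y 0)) (h := v)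
    (dAt (contDiff_comp_coord hθ 0) x) (dAt hv x)
  refine h.trans (add_le_add ?_ ?_)
  · exact mul_le_mul (hθ₀ _) hV₁ (norm_nonneg _) (by have := d.Λ_pos; have := d.hb; positivity)
  · exact mul_le_mul hV₀ ((norm_fderiv_comp_coord_le (hθ.differentiable (by simp)) 0 x).trans
      (hθ₁ _)) (norm_nonneg _) hV₀n

/-- **`‖Dc₁‖ ≤ 39408 Λ⁴ E`** in the cube. [folklore] -/
theorem norm_fderiv_c₁_le {x : ℝ³} (hx : x ∈ cube b) :
    ‖fderiv ℝ (c₁ a b g) x‖ ≤ 39408 * Λ a b ^ 4 * (G₀ + b * G₁) := by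
  have hL := d.Λ_pos; have hb := d.hb; have hE := d.E_nonneg; have hL1 := d.one_le_Λ
  have hvp := d.v2_bounds (gp_contDiff d.smooth) d.Hp_bounds hx
  have hvm := d.v2_bounds (gm_contDiff d.smooth) d.Hm_bounds hx
  have hv2p := v2_contDiff (a := a) (b := b) (gp_contDiff (a := a) d.smooth) (-mass a b g)
  have hv2m := v2_contDiff (a := a) (b := b) (gm_contDiff (a := a) d.smooth) (mass a b g)
  have h1 := d.norm_fderiv_θ_mul_le (θp_contDiff a b) d.abs_θp_le d.abs_deriv_θp_le hv2p hvp.1 hvp.2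
  have h2 := d.norm_fderiv_θ_mul_le (θm_contDiff a b) d.abs_θm_le d.abs_deriv_θm_le hv2m hvm.1 hvm.2
  have d1 := dAt ((contDiff_comp_coord (θp_contDiff a b) 0).mul hv2p) x
  have d2 := dAt ((contDiff_comp_coord (θm_contDiff a b) 0).mul hv2m) x
  have hc : HasFDerivAt (c₁ a b g)
      (fderiv ℝ (fun y => θp a b (y 0) * v2 a b (gp a g) (-mass a b g) y) x +
        fderiv ℝ (fun y => θm a b (y 0) * v2 a b (gm a g) (mass a b g) y) x) x := by
    rw [c₁_eq]; exact d1.hasFDerivAt.add d2.hasFDerivAt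
  rw [hc.fderiv]
  refine (norm_add_le _ _).trans ?_
  have e : 2 * Λ a b / b * (8004 * Λ a b ^ 3 * b * (G₀ + b * G₁)) +
      924 * Λ a b ^ 2 * b ^ 2 * (G₀ + b * G₁) * (4 * Λ a b ^ 2 / b ^ 2) =
      19704 * Λ a b ^ 4 * (G₀ + b * G₁) := by field_simp; ring
  linarith

/-- **`‖Dv₃‖ ≤ 31488 Λ⁴ b E`** and **`|v₃| ≤ 1584 Λ³ b² E`** in the cube. [folklore] -/
theorem v3_bounds {h : ℝ³ → ℝ} {μ : ℝ} (hh : ContDiff ℝ ∞ h)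
    (hH : ∀ y, |H a b h μ y| ≤ 132 * Λ a b ^ 2 * b * (G₀ + b * G₁) ∧
      ‖fderiv ℝ (H a b h μ) y‖ ≤ 408 * Λ a b ^ 3 * (G₀ + b * G₁)) {x : ℝ³} (hx : x ∈ cube b) :
    |v3 a b h μ x| ≤ 1584 * Λ a b ^ 3 * b ^ 2 * (G₀ + b * G₁) ∧
    ‖fderiv ℝ (v3 a b h μ) x‖ ≤ 31488 * Λ a b ^ 4 * b * (G₀ + b * G₁) := by
  have hL := d.Λ_pos; have hb := d.hb; have hE := d.E_nonneg; have hL1 := d.one_le_Λ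
  have hJ := fun y => d.J_bounds hh hH y
  have hJc : ContDiff ℝ ∞ (tot 1 (-(2 * b)) (2 * b) (H a b h μ)) := contDiff_tot 1 _ _ (H_contDiff hh μ)
  set P := prim 2 (-(2 * b)) (tot 1 (-(2 * b)) (2 * b) (H a b h μ)) with hP
  -- the primitive along `x₂`
  have hP0 : |P x| ≤ 1584 * Λ a b ^ 2 * b ^ 3 * (G₀ + b * G₁) := by
    have h1 := abs_prim_le (i := 2) (a₀ := -(2 * b)) (fun y => (hJ y).1) x
    have h2 : |x 2 - -(2 * b)| * (528 * Λ a b ^ 2 * b ^ 2 * (G₀ + b * G₁)) ≤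
        3 * b * (528 * Λ a b ^ 2 * b ^ 2 * (G₀ + b * G₁)) :=
      mul_le_mul_of_nonneg_right (abs_coord_add_le hx 2) (by positivity)
    refine (h1.trans h2).trans (le_of_eq ?_); ring
  have hP1 : ‖fderiv ℝ P x‖ ≤ 29904 * Λ a b ^ 3 * b ^ 2 * (G₀ + b * G₁) := by
    have h1 := norm_fderiv_prim_le (i := 2) (a₀ := -(2 * b)) hJc (fun y => (hJ y).1) (by positivity)
      (fun y => (hJ y).2) x
    have h2 : |x 2 - -(2 * b)| * (4896 * Λ a b ^ 3 * b * (G₀ + b * G₁)) ≤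
        3 * b * (4896 * Λ a b ^ 3 * b * (G₀ + b * G₁)) :=
      mul_le_mul_of_nonneg_right (abs_coord_add_le hx 2) (by positivity)
    have hm : Λ a b ^ 2 * b ^ 2 * (G₀ + b * G₁) ≤ Λ a b ^ 3 * b ^ 2 * (G₀ + b * G₁) := by
      have := d.Λ_le_Λ_pow (show 2 ≤ 3 by norm_num)
      have hbE : 0 ≤ b ^ 2 * (G₀ + b * G₁) := by positivity
      nlinarith
    nlinarith
  have hd1 : DifferentiableAt ℝ (fun y : ℝ³ => η b (y 1)) x := dAt (contDiff_comp_coord (η_contDiff b) 1) x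
  have hd2 : DifferentiableAt ℝ P x := dAt (contDiff_prim 2 _ hJc) x
  refine ⟨?_, ?_⟩
  · rw [v3, abs_mul]
    calc |η b (x 1)| * |P x| ≤ (Λ a b / b) * (1584 * Λ a b ^ 2 * b ^ 3 * (G₀ + b * G₁)) :=
          mul_le_mul (d.abs_η_le _) hP0 (abs_nonneg _) (by positivity)
      _ = 1584 * Λ a b ^ 3 * b ^ 2 * (G₀ + b * G₁) := by field_simp
  · have hm := norm_fderiv_mul_le hd1 hd2
    rw [show (fun y : ℝ³ => η b (y 1) * P y) = v3 a b h μ from rfl] at hm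
    refine hm.trans ?_
    have p1 : |η b (x 1)| * ‖fderiv ℝ P x‖ ≤ (Λ a b / b) * (29904 * Λ a b ^ 3 * b ^ 2 * (G₀ + b * G₁)) :=
      mul_le_mul (d.abs_η_le _) hP1 (norm_nonneg _) (by positivity)
    have p2 : |P x| * ‖fderiv ℝ (fun y : ℝ³ => η b (y 1)) x‖ ≤
        (1584 * Λ a b ^ 2 * b ^ 3 * (G₀ + b * G₁)) * (Λ a b / b ^ 2) :=
      mul_le_mul hP0 ((norm_fderiv_comp_coord_le (bump_contDiff 0 b (n := 1) |>.differentiable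
        (by simp)) 1 x).trans (d.abs_deriv_η_le _)) (norm_nonneg _) (by positivity)
    have e1 : (Λ a b / b) * (29904 * Λ a b ^ 3 * b ^ 2 * (G₀ + b * G₁)) =
        29904 * Λ a b ^ 4 * b * (G₀ + b * G₁) := by field_simp
    have e2 : (1584 * Λ a b ^ 2 * b ^ 3 * (G₀ + b * G₁)) * (Λ a b / b ^ 2) =
        1584 * Λ a b ^ 3 * b * (G₀ + b * G₁) := by field_simp
    rw [e1] at p1; rw [e2] at p2
    have hm : Λ a b ^ 3 * b * (G₀ + b * G₁) ≤ Λ a b ^ 4 * b * (G₀ + b * G₁) := by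
      have := d.Λ_le_Λ_pow (show 3 ≤ 4 by norm_num)
      have hbE : 0 ≤ b * (G₀ + b * G₁) := by positivity
      nlinarith
    nlinarith

/-- **`‖Dc₂‖ ≤ 138624 Λ⁵ E`** in the cube. [folklore] -/
theorem norm_fderiv_c₂_le {x : ℝ³} (hx : x ∈ cube b) :
    ‖fderiv ℝ (c₂ a b g) x‖ ≤ 138624 * Λ a b ^ 5 * (G₀ + b * G₁) := by
  have hL := d.Λ_pos; have hb := d.hb; have hE := d.E_nonneg; have hL1 := d.one_le_Λ
  have hvp := d.v3_bounds (gp_contDiff d.smooth) d.Hp_bounds hx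
  have hvm := d.v3_bounds (gm_contDiff d.smooth) d.Hm_bounds hx
  have hv3p := v3_contDiff (a := a) (b := b) (gp_contDiff (a := a) d.smooth) (-mass a b g)
  have hv3m := v3_contDiff (a := a) (b := b) (gm_contDiff (a := a) d.smooth) (mass a b g)
  have h1 := d.norm_fderiv_θ_mul_le (θp_contDiff a b) d.abs_θp_le d.abs_deriv_θp_le hv3p hvp.1 hvp.2
  have h2 := d.norm_fderiv_θ_mul_le (θm_contDiff a b) d.abs_θm_le d.abs_deriv_θm_le hv3m hvm.1 hvm.2
  have d1 := dAt ((contDiff_comp_coord (θp_contDiff a b) 0).mul hv3p) x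
  have d2 := dAt ((contDiff_comp_coord (θm_contDiff a b) 0).mul hv3m) x
  have hc : HasFDerivAt (c₂ a b g)
      (fderiv ℝ (fun y => θp a b (y 0) * v3 a b (gp a g) (-mass a b g) y) x +
        fderiv ℝ (fun y => θm a b (y 0) * v3 a b (gm a g) (mass a b g) y) x) x := by
    rw [c₂_eq]; exact d1.hasFDerivAt.add d2.hasFDerivAt
  rw [hc.fderiv]
  refine (norm_add_le _ _).trans ?_
  have e : 2 * Λ a b / b * (31488 * Λ a b ^ 4 * b * (G₀ + b * G₁)) +
      1584 * Λ a b ^ 3 * b ^ 2 * (G₀ + b * G₁) * (4 * Λ a b ^ 2 / b ^ 2) =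
      69312 * Λ a b ^ 5 * (G₀ + b * G₁) := by field_simp; ring
  linarith

/-- **`‖DW‖ ≤ 179402 Λ⁵ E` in the cube.** [folklore] -/
theorem norm_fderiv_W_le_of_mem {x : ℝ³} (hx : x ∈ cube b) :
    ‖fderiv ℝ (W a b g) x‖ ≤ 179402 * Λ a b ^ 5 * (G₀ + b * G₁) := by
  have hL := d.Λ_pos; have hE := d.E_nonneg; have hL1 := d.one_le_Λ
  have h0 := d.norm_fderiv_c₀_le hx
  have h1 := d.norm_fderiv_c₁_le hx
  have h2 := d.norm_fderiv_c₂_le hx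
  have d0 := dAt (c₀_contDiff (a := a) (b := b) d.smooth) x
  have d1 := dAt (c₁_contDiff (a := a) (b := b) d.smooth) x
  have d2 := dAt (c₂_contDiff (a := a) (b := b) d.smooth) x
  have hW : HasFDerivAt (W a b g)
      ((fderiv ℝ (c₀ a b g) x).smulRight (e 0) + (fderiv ℝ (c₁ a b g) x).smulRight (e 1) +
        (fderiv ℝ (c₂ a b g) x).smulRight (e 2)) x :=
    ((d0.hasFDerivAt.smul_const (e 0)).add (d1.hasFDerivAt.smul_const (e 1))).add
      (d2.hasFDerivAt.smul_const (e 2))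
  rw [hW.fderiv]
  have hn : ∀ (L : ℝ³ →L[ℝ] ℝ) (i : Fin 3), ‖L.smulRight (e i)‖ = ‖L‖ := fun L i => by
    rw [ContinuousLinearMap.norm_smulRight_apply, norm_e, mul_one]
  have h35 : Λ a b ^ 3 * (G₀ + b * G₁) ≤ Λ a b ^ 5 * (G₀ + b * G₁) :=
    mul_le_mul_of_nonneg_right (d.Λ_le_Λ_pow (show 3 ≤ 5 by norm_num)) hE
  have h45 : Λ a b ^ 4 * (G₀ + b * G₁) ≤ Λ a b ^ 5 * (G₀ + b * G₁) :=
    mul_le_mul_of_nonneg_right (d.Λ_le_Λ_pow (show 4 ≤ 5 by norm_num)) hE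
  calc _ ≤ ‖(fderiv ℝ (c₀ a b g) x).smulRight (e 0) + (fderiv ℝ (c₁ a b g) x).smulRight (e 1)‖ +
        ‖(fderiv ℝ (c₂ a b g) x).smulRight (e 2)‖ := norm_add_le _ _
    _ ≤ ‖(fderiv ℝ (c₀ a b g) x).smulRight (e 0)‖ + ‖(fderiv ℝ (c₁ a b g) x).smulRight (e 1)‖ +
        ‖(fderiv ℝ (c₂ a b g) x).smulRight (e 2)‖ := by gcongr; exact norm_add_le _ _
    _ = ‖fderiv ℝ (c₀ a b g) x‖ + ‖fderiv ℝ (c₁ a b g) x‖ + ‖fderiv ℝ (c₂ a b g) x‖ := by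
        rw [hn, hn, hn]
    _ ≤ _ := by linarith

end BData

/-! #### The main theorem -/

/-- **An explicit right inverse of the divergence on cubical shells.** There are absolute
constants `K > 0` and `N` such that: for `0 < a < b ≤ 2a` and `g ∈ C^∞(ℝ³)` vanishing off the
closed cubical shell `{a ≤ maxᵢ|xᵢ| ≤ b}` with `∫ g = 0`, `|g| ≤ G₀` and `‖Dg‖ ≤ G₁`, there is a
`C¹` (indeed `C^∞`) vector field `w` supported in the same shell with `div w = g` and
`‖Dw(x)‖ ≤ K (b/(b-a))^N (G₀ + b G₁)` for all `x`. (Folklore; compactly supported Poincaré lemma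
in top degree with `sup`-norm bookkeeping. One derivative is lost.) [folklore] -/
theorem exists_divergence_rightInverse :
    ∃ K : ℝ, 0 < K ∧ ∃ N : ℕ, ∀ (a b : ℝ) (g : ℝ³ → ℝ) (G₀ G₁ : ℝ), 0 < a → a < b → b ≤ 2 * a →
      ContDiff ℝ ∞ g → (∀ x, x ∉ shell a b → g x = 0) → ∫ x, g x = 0 →
      (∀ x, |g x| ≤ G₀) → (∀ x, ‖fderiv ℝ g x‖ ≤ G₁) →
      ∃ w : ℝ³ → ℝ³, ContDiff ℝ ∞ w ∧ tsupport w ⊆ shell a b ∧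
        (∀ x, VectorCalculus.divergence w x = g x) ∧
        ∀ x, ‖fderiv ℝ w x‖ ≤ K * (b / (b - a)) ^ N * (G₀ + b * G₁) := by
  refine ⟨179402 * B ^ 5, by have := B_pos; positivity, 5, ?_⟩
  intro a b g G₀ G₁ ha hab hb2 hg hg0 hint hG₀ hG₁
  have dd : Datum a b g := ⟨ha, hab, hg, hg0, hint⟩
  have bd : BData a b g G₀ G₁ := ⟨ha, hab, hb2, hg, hG₀, hG₁⟩
  refine ⟨W a b g, W_contDiff hg, dd.tsupport_W_subset, divergence_W hg, fun x => ?_⟩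
  have hΛ : Λ a b ^ 5 = B ^ 5 * (b / (b - a)) ^ 5 := by rw [Λ, ← mul_pow, mul_div_assoc]
  by_cases hx : x ∈ cube b
  · refine (bd.norm_fderiv_W_le_of_mem hx).trans (le_of_eq ?_)
    rw [hΛ]; ring
  · have hx' : x ∉ tsupport (W a b g) := fun h => hx (shell_subset_cube a b (dd.tsupport_W_subset h))
    rw [fderiv_of_notMem_tsupport ℝ hx', norm_zero]
    have := bd.E_nonneg
    have : 0 ≤ b / (b - a) := div_nonneg bd.hb.le bd.hℓ.le
    have := B_pos
    positivity

end DerivBounds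

end CubeShell

end Literature.Analysis.FluidPDE

end
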